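import Literature.Topology.PlanarFoliations.Transversals
import Literature.Topology.PlaneTopology.JordanCurveProofs
import Mathlib.Topology.Algebra.Order.Floor
import HarnessLib

/-!
# The Bendixson sack of two successive crossings

Topic: Topology / PlanarFoliations, sequel to `Transversals.lean`. Let `F` be a bi-oriented
foliation with one-dimensional leaves of a space `X` embedded in the plane by `ι : X → ℂ`
(continuous, injective, open), `L = F.Leaf x` an open leaf, and `p₁ < p₂` two **successive
crossings** of `L` with the vertical `u = u₀` of a flow box `e` (no crossing strictly between
them in the order of the leaf): a `SackData`. The leaf arc `[p₁, p₂]` followed by the vertical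
segment from `p₂` back to `p₁` is a **Jordan curve** — the boundary of the *Bendixson sack*.

This file constructs that curve:

* `SackData.arc`, `SackData.vert`, the loop `SackData.loop : ℝ → ℂ` (**definitions**);
* `SackData.continuous_loop`, `SackData.periodic_loop`, and **injectivity on a period**
  (`SackData.injOn_loop`): the leaf arc and the vertical segment meet only at `p₁`, `p₂`, for an
  interior common point would be a crossing strictly between them (order-convexity of the
  interval, `leafIcc_eq_image`);
* `SackData.range_loop`: the curve is `ι '' (pt '' [p₁, p₂] ∪ e.symm '' ({u₀} × [t⁻, t⁺]))`;
* `SackData.jordan`: the Jordan curve theorem (`JordanCurveTheorem_holds`) applied to it.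

All statements are [folklore] (Bendixson 1901; Camacho–Lins Neto Ch. VI §4).
-/

noncomputable section

open Set Filter Function
open _root_.Topology
open Literature.Topology.FourManifolds Literature.Topology.FourManifolds.Foliation
  Literature.Topology.FourManifolds.OneManifold Literature.Topology.PlaneTopology

namespace Literature.Topology.PlanarFoliations

variable {X : Type*} [TopologicalSpace X] [T2Space X] [SecondCountableTopology X] {F : Foliation ℝ X}
variable {hbi : IsBiOriented F} {e : OpenPartialHomeomorph X (ℝ × ℝ)} {u₀ : ℝ}

/-- **Two successive crossings** `p₁ < p₂` of the open leaf `F.Leaf x` with the vertical `u = u₀`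
of the flow box `e`: no crossing with height between theirs lies strictly between them in the
order of the leaf. [folklore] -/
structure SackData (hbi : IsBiOriented F) (x : X) [NoncompactSpace (F.Leaf x)] (e : OpenPartialHomeomorph X (ℝ × ℝ))
    (u₀ : ℝ) where
  /-- the first crossing -/
  p₁ : F.Leaf x
  /-- the second crossing -/
  p₂ : F.Leaf x
  /-- `p₁` is before `p₂` -/
  lt : leafLT hbi p₁ p₂
  /-- `p₁` is a crossing -/
  cross₁ : IsCrossing e u₀ p₁
  /-- `p₂` is a crossing -/
  cross₂ : IsCrossing e u₀ p₂
  /-- no crossing strictly between them has height between theirs -/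
  succ : ∀ s, leafLT hbi p₁ s → leafLT hbi s p₂ → IsCrossing e u₀ s → ht e s ∉ uIcc (ht e p₂) (ht e p₁)

namespace SackData

variable {x : X} [NoncompactSpace (F.Leaf x)] (D : SackData hbi x e u₀)

/-- The index of a line chart containing the interval `[p₁, p₂]`. [folklore] -/
def idx : ℕ := (exists_subset_lineCharts_source (hbi := hbi) (isCompact_leafIcc (hbi := hbi) D.p₁ D.p₂)).choose

/-- The chosen line chart contains the interval `[p₁, p₂]`. [folklore] -/
theorem leafIcc_subset_source : leafIcc hbi D.p₁ D.p₂ ⊆ (lineCharts hbi x D.idx).source :=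
  (exists_subset_lineCharts_source (hbi := hbi) (isCompact_leafIcc (hbi := hbi) D.p₁ D.p₂)).choose_spec

/-- The line chart containing the interval. [folklore] -/
abbrev g : OpenPartialHomeomorph (F.Leaf x) ℝ := lineCharts hbi x D.idx

/-- The line chart is an arc chart. [folklore] -/
theorem g_target : D.g.target = univ := lineCharts_target hbi D.idx

/-- `p₁` lies in the source of the line chart. [folklore] -/
theorem p₁_mem : D.p₁ ∈ D.g.source := D.leafIcc_subset_source (left_mem_leafIcc (leafLT_asymm D.lt))

/-- `p₂` lies in the source of the line chart. [folklore] -/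
theorem p₂_mem : D.p₂ ∈ D.g.source := D.leafIcc_subset_source (right_mem_leafIcc (leafLT_asymm D.lt))

/-- The readings of the two crossings. [folklore] -/
def a : ℝ := D.g D.p₁

/-- The readings of the two crossings. [folklore] -/
def b : ℝ := D.g D.p₂

/-- The readings satisfy `a < b`. [folklore] -/
theorem a_lt_b : D.a < D.b := (leafLT_iff D.p₁_mem D.p₂_mem).1 D.lt

/-- The heights of the two crossings. [folklore] -/
def t₁ : ℝ := ht e D.p₁

/-- The heights of the two crossings. [folklore] -/
def t₂ : ℝ := ht e D.p₂

/-- The two crossings have different heights. [folklore] -/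
theorem t₁_ne_t₂ : D.t₁ ≠ D.t₂ := fun h ↦
  (leafLT_irrefl (hbi := hbi) D.p₁) (by simpa [D.cross₁.eq_of_ht_eq D.cross₂ h] using D.lt)

/-- The interval `[p₁, p₂]` read in the line chart. [folklore] -/
theorem leafIcc_eq : leafIcc hbi D.p₁ D.p₂ = D.g.symm '' Icc D.a D.b := leafIcc_eq_image D.p₁_mem D.p₂_mem

/-! ### The two arcs -/

/-- **The leaf arc** of the sack, parametrised by the line chart: `s ↦ pt (g⁻¹ s)`. [folklore] -/
def arc (s : ℝ) : X := Leaf.pt (D.g.symm s)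

/-- **The vertical** of the sack: `t ↦ e⁻¹ (u₀, t)`. [folklore] -/
def vert (e : OpenPartialHomeomorph X (ℝ × ℝ)) (u₀ t : ℝ) : X := e.symm (u₀, t)

/-- The leaf arc is continuous. [folklore] -/
theorem continuous_arc : Continuous D.arc :=
  (Leaf.continuous_coe F x).comp (arc_continuous_symm D.g_target)

/-- The leaf arc is injective. [folklore] -/
theorem injective_arc : Injective D.arc := fun s s' h ↦ by
  have h' : D.g.symm s = D.g.symm s' := Leaf.injective_coe F x h
  rw [← arc_apply_symm D.g_target s, ← arc_apply_symm D.g_target s', h']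

omit [T2Space X] [SecondCountableTopology X] [NoncompactSpace (F.Leaf x)] in
/-- The vertical is continuous. [folklore] -/
theorem continuous_vert (he : e ∈ F.atlas) : Continuous (vert e u₀) := by
  have := e.continuousOn_symm
  rw [F.target_eq e he, continuousOn_univ] at this
  exact this.comp (continuous_const.prodMk continuous_id)

omit [T2Space X] [SecondCountableTopology X] [NoncompactSpace (F.Leaf x)] in
/-- The vertical is injective. [folklore] -/
theorem injective_vert (he : e ∈ F.atlas) : Injective (vert e u₀) := fun t t' h ↦ by
  have := congrArg e h
  simp only [vert] at this
  rw [e.right_inv (by rw [F.target_eq e he]; exact mem_univ _),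
    e.right_inv (by rw [F.target_eq e he]; exact mem_univ _)] at this
  exact (Prod.ext_iff.1 this).2

/-- The leaf arc starts at `pt p₁`. [folklore] -/
theorem arc_a : D.arc D.a = Leaf.pt D.p₁ := by
  simp only [arc, a, D.g.left_inv D.p₁_mem]

/-- The leaf arc ends at `pt p₂`. [folklore] -/
theorem arc_b : D.arc D.b = Leaf.pt D.p₂ := by
  simp only [arc, b, D.g.left_inv D.p₂_mem]

/-- The vertical passes through `pt p₁` at height `t₁`. [folklore] -/
theorem vert_t₁ : vert e u₀ D.t₁ = Leaf.pt D.p₁ := D.cross₁.pt_eq.symm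

/-- The vertical passes through `pt p₂` at height `t₂`. [folklore] -/
theorem vert_t₂ : vert e u₀ D.t₂ = Leaf.pt D.p₂ := D.cross₂.pt_eq.symm

/-- A point of the leaf arc is a point of the interval `[p₁, p₂]`. [folklore] -/
theorem symm_mem_leafIcc {s : ℝ} (hs : s ∈ Icc D.a D.b) : D.g.symm s ∈ leafIcc hbi D.p₁ D.p₂ := by
  rw [D.leafIcc_eq]; exact mem_image_of_mem _ hs

/-- Convex combinations of the two heights lie in the height segment. [folklore] -/
theorem combo_mem_uIcc {lam : ℝ} (h0 : 0 ≤ lam) (h1 : lam ≤ 1) : D.t₂ + lam * (D.t₁ - D.t₂) ∈ uIcc D.t₂ D.t₁ := by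
  rcases le_total D.t₂ D.t₁ with h | h
  · rw [uIcc_of_le h]; constructor <;> nlinarith
  · rw [uIcc_of_ge h]; constructor <;> nlinarith

/-- **The leaf arc and the vertical segment meet only at the two crossings.** [folklore] -/
theorem arc_eq_vert (he : e ∈ F.atlas) {s t : ℝ} (hs : s ∈ Icc D.a D.b) (htI : t ∈ uIcc D.t₂ D.t₁)
    (h : D.arc s = vert e u₀ t) : (s = D.a ∧ t = D.t₁) ∨ (s = D.b ∧ t = D.t₂) := by
  set r := D.g.symm s with hr
  have hrI : r ∈ leafIcc hbi D.p₁ D.p₂ := D.symm_mem_leafIcc hs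
  have hsrc : Leaf.pt r ∈ e.source := by
    show D.arc s ∈ e.source
    rw [h]; exact e.map_target (by rw [F.target_eq e he]; exact mem_univ _)
  have her : e (Leaf.pt r) = (u₀, t) := by
    show e (D.arc s) = (u₀, t)
    rw [h, vert, e.right_inv (by rw [F.target_eq e he]; exact mem_univ _)]
  have hcr : IsCrossing e u₀ r := ⟨hsrc, by rw [her]⟩
  have hht : ht e r = t := by show (e (Leaf.pt r)).2 = t; rw [her]
  have hgs : D.g r = s := arc_apply_symm D.g_target s
  -- `r` is `p₁`, `p₂`, or strictly between (excluded)
  rcases not_leafLT_iff.1 hrI.1 with h₁ | h₁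
  · rcases not_leafLT_iff.1 hrI.2 with h₂ | h₂
    · exact (D.succ r h₁ h₂ hcr (by rw [hht]; exact htI)).elim
    · right
      refine ⟨?_, ?_⟩
      · rw [← hgs, h₂]; rfl
      · rw [← hht, h₂]; rfl
  · left
    refine ⟨?_, ?_⟩
    · rw [← hgs, ← h₁]; rfl
    · rw [← hht, ← h₁]; rfl

/-! ### The loop -/

/-- The loop on one period: the leaf arc on `[0, 1/2]`, the vertical back on `[1/2, 1]`.
[folklore] -/
def loop₀ (ι : X → ℂ) (θ : ℝ) : ℂ :=
  if θ ≤ 1 / 2 then ι (D.arc (D.a + 2 * θ * (D.b - D.a)))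
  else ι (vert e u₀ (D.t₂ + (2 * θ - 1) * (D.t₁ - D.t₂)))

/-- **The boundary of the Bendixson sack** as a `1`-periodic loop. [folklore] -/
def loop (ι : X → ℂ) (θ : ℝ) : ℂ := D.loop₀ ι (Int.fract θ)

variable {ι : X → ℂ}

/-- The loop on `[0, 1/2]`. [folklore] -/
theorem loop₀_of_le {θ : ℝ} (h : θ ≤ 1 / 2) : D.loop₀ ι θ = ι (D.arc (D.a + 2 * θ * (D.b - D.a))) := if_pos h

/-- The loop on `(1/2, 1]`. [folklore] -/
theorem loop₀_of_gt {θ : ℝ} (h : 1 / 2 < θ) :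
    D.loop₀ ι θ = ι (vert e u₀ (D.t₂ + (2 * θ - 1) * (D.t₁ - D.t₂))) := if_neg (not_le.2 h)

/-- The loop on `[1/2, 1]`. [folklore] -/
theorem loop₀_of_ge {θ : ℝ} (h : 1 / 2 ≤ θ) :
    D.loop₀ ι θ = ι (vert e u₀ (D.t₂ + (2 * θ - 1) * (D.t₁ - D.t₂))) := by
  rcases h.lt_or_eq with h | h
  · exact D.loop₀_of_gt h
  · rw [← h, D.loop₀_of_le le_rfl]
    norm_num
    rw [D.arc_b, ← D.vert_t₂]

/-- The loop at `0`. [folklore] -/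
theorem loop₀_zero : D.loop₀ ι 0 = ι (Leaf.pt D.p₁) := by
  rw [D.loop₀_of_le (by norm_num)]; norm_num; rw [D.arc_a]

/-- The loop at `1`. [folklore] -/
theorem loop₀_one : D.loop₀ ι 1 = ι (Leaf.pt D.p₁) := by
  rw [D.loop₀_of_gt (by norm_num)]; norm_num; rw [D.vert_t₁]

/-- The loop is continuous on one period. [folklore] -/
theorem continuousOn_loop₀ (he : e ∈ F.atlas) (hι : Continuous ι) : ContinuousOn (D.loop₀ ι) (Icc 0 1) := by
  have h₁ : Continuous fun θ : ℝ ↦ ι (D.arc (D.a + 2 * θ * (D.b - D.a))) :=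
    hι.comp (D.continuous_arc.comp (by fun_prop))
  have h₂ : Continuous fun θ : ℝ ↦ ι (vert e u₀ (D.t₂ + (2 * θ - 1) * (D.t₁ - D.t₂))) :=
    hι.comp ((continuous_vert he).comp (by fun_prop))
  refine (Continuous.if_le h₁ h₂ continuous_id continuous_const ?_).continuousOn
  rintro θ rfl
  norm_num
  rw [D.arc_b, ← D.vert_t₂]

/-- **The sack boundary loop is continuous.** [folklore] -/
theorem continuous_loop (he : e ∈ F.atlas) (hι : Continuous ι) : Continuous (D.loop ι) :=
  ContinuousOn.comp_fract'' (D.continuousOn_loop₀ he hι) (D.loop₀_zero.trans D.loop₀_one.symm)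

/-- **The sack boundary loop is `1`-periodic.** [folklore] -/
theorem periodic_loop : Periodic (D.loop ι) 1 := fun θ ↦ by
  simp only [loop, Int.fract_add_one]

/-- The loop on `[0, 1)`. [folklore] -/
theorem loop_of_mem_Ico {θ : ℝ} (h : θ ∈ Ico (0 : ℝ) 1) : D.loop ι θ = D.loop₀ ι θ := by
  rw [loop, Int.fract_eq_self.2 h]

/-- **The loop is injective on a period.** [folklore] -/
theorem injOn_loop (he : e ∈ F.atlas) (hι : Injective ι) : InjOn (D.loop ι) (Ico 0 1) := by
  have hab := D.a_lt_b
  have ht := D.t₁_ne_t₂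
  -- parameters of the two pieces
  have hsI : ∀ θ : ℝ, 0 ≤ θ → θ ≤ 1 / 2 → D.a + 2 * θ * (D.b - D.a) ∈ Icc D.a D.b := fun θ h0 h1 ↦
    ⟨by nlinarith, by nlinarith⟩
  intro θ hθ θ' hθ' hEq
  rw [D.loop_of_mem_Ico hθ, D.loop_of_mem_Ico hθ'] at hEq
  rcases le_or_gt θ (1 / 2) with h₁ | h₁ <;> rcases le_or_gt θ' (1 / 2) with h₂ | h₂
  · -- both on the arc
    rw [D.loop₀_of_le h₁, D.loop₀_of_le h₂] at hEq
    have := D.injective_arc (hι hEq)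
    rcases eq_or_ne (D.b - D.a) 0 with h0 | h0
    · linarith
    · have : 2 * θ * (D.b - D.a) = 2 * θ' * (D.b - D.a) := by linarith
      have := mul_right_cancel₀ h0 this
      linarith
  · -- arc / vertical
    rw [D.loop₀_of_le h₁, D.loop₀_of_gt h₂] at hEq
    rcases D.arc_eq_vert he (hsI θ hθ.1 h₁) (D.combo_mem_uIcc (by linarith) (by linarith [hθ'.2])) (hι hEq) with
      ⟨-, hte⟩ | ⟨hse, hte⟩
    · -- `t = t₁` forces `θ' = 1`
      have : (2 * θ' - 1) * (D.t₁ - D.t₂) = 1 * (D.t₁ - D.t₂) := by linarith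
      have := mul_right_cancel₀ (sub_ne_zero.2 ht) this
      linarith [hθ'.2]
    · have : (2 * θ' - 1) * (D.t₁ - D.t₂) = 0 * (D.t₁ - D.t₂) := by linarith
      have := mul_right_cancel₀ (sub_ne_zero.2 ht) this
      linarith
  · rw [D.loop₀_of_gt h₁, D.loop₀_of_le h₂] at hEq
    rcases D.arc_eq_vert he (hsI θ' hθ'.1 h₂) (D.combo_mem_uIcc (by linarith) (by linarith [hθ.2])) (hι hEq.symm) with
      ⟨-, hte⟩ | ⟨hse, hte⟩
    · have : (2 * θ - 1) * (D.t₁ - D.t₂) = 1 * (D.t₁ - D.t₂) := by linarith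
      have := mul_right_cancel₀ (sub_ne_zero.2 ht) this
      linarith [hθ.2]
    · have : (2 * θ - 1) * (D.t₁ - D.t₂) = 0 * (D.t₁ - D.t₂) := by linarith
      have := mul_right_cancel₀ (sub_ne_zero.2 ht) this
      linarith
  · -- both on the vertical
    rw [D.loop₀_of_gt h₁, D.loop₀_of_gt h₂] at hEq
    have := injective_vert he (hι hEq)
    have : (2 * θ - 1) * (D.t₁ - D.t₂) = (2 * θ' - 1) * (D.t₁ - D.t₂) := by linarith
    have := mul_right_cancel₀ (sub_ne_zero.2 ht) this
    linarith

/-! ### The range of the loop and the Jordan curve theorem -/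

/-- The trace of the sack boundary in `X`: the leaf arc and the vertical segment. [folklore] -/
def traceX : Set X := D.arc '' Icc D.a D.b ∪ vert e u₀ '' uIcc D.t₂ D.t₁

/-- **The trace of the loop** is `ι '' traceX`. [folklore] -/
theorem range_loop : range (D.loop ι) = ι '' D.traceX := by
  apply Subset.antisymm
  · rintro _ ⟨θ, rfl⟩
    rw [loop]
    have hf : Int.fract θ ∈ Ico (0 : ℝ) 1 := ⟨Int.fract_nonneg θ, Int.fract_lt_one θ⟩
    set φ := Int.fract θ
    rcases le_or_gt φ (1 / 2) with h | h
    · rw [D.loop₀_of_le h]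
      refine mem_image_of_mem ι (Or.inl (mem_image_of_mem _ ⟨?_, ?_⟩))
      · nlinarith [D.a_lt_b, hf.1]
      · nlinarith [D.a_lt_b, hf.1]
    · rw [D.loop₀_of_gt h]
      refine mem_image_of_mem ι (Or.inr (mem_image_of_mem _ ?_))
      rw [mem_uIcc]
      rcases le_or_gt D.t₂ D.t₁ with h' | h'
      · left; constructor <;> nlinarith [hf.2]
      · right; constructor <;> nlinarith [hf.2]
  · rintro _ ⟨y, hy, rfl⟩
    rcases hy with ⟨s, hs, rfl⟩ | ⟨t, ht', rfl⟩
    · -- `s = a + 2θ(b - a)` with `θ ∈ [0, 1/2]`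
      have hba : 0 < D.b - D.a := sub_pos.2 D.a_lt_b
      set θ := (s - D.a) / (2 * (D.b - D.a)) with hθ
      have hθ0 : 0 ≤ θ := div_nonneg (by linarith [hs.1]) (by linarith)
      have hθ1 : θ ≤ 1 / 2 := by rw [hθ, div_le_iff₀ (by linarith)]; linarith [hs.2]
      have hsθ : D.a + 2 * θ * (D.b - D.a) = s := by rw [hθ]; field_simp; ring
      refine ⟨θ, ?_⟩
      rw [D.loop_of_mem_Ico ⟨hθ0, by linarith⟩, D.loop₀_of_le hθ1, hsθ]
    · -- `t = t₂ + (2θ - 1)(t₁ - t₂)` with `θ ∈ [1/2, 1]`; the value `θ = 1` is `θ = 0`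
      have hne : D.t₁ - D.t₂ ≠ 0 := sub_ne_zero.2 D.t₁_ne_t₂
      set θ := ((t - D.t₂) / (D.t₁ - D.t₂) + 1) / 2 with hθ
      have htθ : D.t₂ + (2 * θ - 1) * (D.t₁ - D.t₂) = t := by rw [hθ]; field_simp; ring
      have hlam : 0 ≤ (t - D.t₂) / (D.t₁ - D.t₂) ∧ (t - D.t₂) / (D.t₁ - D.t₂) ≤ 1 := by
        rw [mem_uIcc] at ht'
        rcases ht' with ⟨h1, h2⟩ | ⟨h1, h2⟩
        · have hpos : 0 < D.t₁ - D.t₂ := by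
            rcases (sub_nonneg.2 (h1.trans h2)).lt_or_eq with h | h
            · exact h
            · exact absurd h.symm hne
          exact ⟨div_nonneg (by linarith) hpos.le, by rw [div_le_one hpos]; linarith⟩
        · have hneg : D.t₁ - D.t₂ < 0 := by
            rcases (sub_nonpos.2 (h1.trans h2)).lt_or_eq with h | h
            · exact h
            · exact absurd h hne
          exact ⟨div_nonneg_of_nonpos (by linarith) hneg.le, by rw [div_le_one_of_neg hneg]; linarith⟩
      have hθ1 : 1 / 2 ≤ θ := by rw [hθ]; linarith [hlam.1]
      have hθ2 : θ ≤ 1 := by rw [hθ]; linarith [hlam.2]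
      rcases hθ2.lt_or_eq with hlt | heq1
      · refine ⟨θ, ?_⟩
        rw [D.loop_of_mem_Ico ⟨by linarith, hlt⟩, D.loop₀_of_ge hθ1, htθ]
      · -- `θ = 1`: the point is `pt p₁ = loop 0`
        refine ⟨0, ?_⟩
        rw [D.loop_of_mem_Ico ⟨le_rfl, one_pos⟩, D.loop₀_zero, ← D.vert_t₁, ← htθ, heq1]
        norm_num

/-- The sack boundary in `X` is compact. [folklore] -/
theorem isCompact_traceX (he : e ∈ F.atlas) : IsCompact D.traceX :=
  (isCompact_Icc.image D.continuous_arc).union (isCompact_uIcc.image (continuous_vert he))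

/-- **The boundary of the Bendixson sack is a Jordan curve**: the Jordan curve theorem applies
to it. [folklore] -/
theorem jordan (he : e ∈ F.atlas) (hιc : Continuous ι) (hιi : Injective ι) :
    ∃ z w : ℂ, z ∈ (ι '' D.traceX)ᶜ ∧ w ∈ (ι '' D.traceX)ᶜ ∧
      connectedComponentIn (ι '' D.traceX)ᶜ z ≠ connectedComponentIn (ι '' D.traceX)ᶜ w ∧
      (∀ v ∈ (ι '' D.traceX)ᶜ, v ∈ connectedComponentIn (ι '' D.traceX)ᶜ z ∨ v ∈ connectedComponentIn (ι '' D.traceX)ᶜ w) ∧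
      frontier (connectedComponentIn (ι '' D.traceX)ᶜ z) = ι '' D.traceX ∧
      frontier (connectedComponentIn (ι '' D.traceX)ᶜ w) = ι '' D.traceX := by
  obtain ⟨f, -⟩ := exists_homeomorph_addCircle_forall_eq (D.continuous_loop he hιc) D.periodic_loop (D.injOn_loop he hιi)
  rw [D.range_loop] at f
  exact JordanCurveTheorem_holds _ ⟨f⟩

/-! ### The two sides of the vertical segment -/

/-- The lower and upper heights of the segment. [folklore] -/
def tlo : ℝ := min D.t₁ D.t₂

/-- The lower and upper heights of the segment. [folklore] -/
def thi : ℝ := max D.t₁ D.t₂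

/-- The segment has positive length. [folklore] -/
theorem tlo_lt_thi : D.tlo < D.thi := min_lt_max.2 D.t₁_ne_t₂

/-- The height segment as an interval. [folklore] -/
theorem uIcc_eq : uIcc D.t₂ D.t₁ = Icc D.tlo D.thi := by
  rw [tlo, thi, uIcc, min_comm, max_comm]

/-- **An interior point of the vertical segment is not on the leaf arc.** [folklore] -/
theorem vert_not_mem_arc (he : e ∈ F.atlas) {t : ℝ} (ht : t ∈ Ioo D.tlo D.thi) : vert e u₀ t ∉ D.arc '' Icc D.a D.b := by
  rintro ⟨s, hs, hst⟩
  have htI : t ∈ uIcc D.t₂ D.t₁ := by rw [D.uIcc_eq]; exact ⟨ht.1.le, ht.2.le⟩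
  rcases D.arc_eq_vert he hs htI hst with ⟨-, rfl⟩ | ⟨-, rfl⟩
  · have h1 : D.t₂ < D.t₁ := by
      rcases min_lt_iff.1 ht.1 with h | h
      · exact absurd h (lt_irrefl _)
      · exact h
    have h2 : D.t₁ < D.t₂ := by
      rcases lt_max_iff.1 ht.2 with h | h
      · exact absurd h (lt_irrefl _)
      · exact h
    exact lt_asymm h1 h2
  · have h1 : D.t₁ < D.t₂ := by
      rcases min_lt_iff.1 ht.1 with h | h
      · exact h
      · exact absurd h (lt_irrefl _)
    have h2 : D.t₂ < D.t₁ := by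
      rcases lt_max_iff.1 ht.2 with h | h
      · exact h
      · exact absurd h (lt_irrefl _)
    exact lt_asymm h1 h2

omit [T2Space X] [SecondCountableTopology X] [NoncompactSpace (F.Leaf x)] in
/-- The box map `(u, t) ↦ e⁻¹ (u, t)` is continuous. [folklore] -/
theorem continuous_symm (he : e ∈ F.atlas) : Continuous fun q : ℝ × ℝ ↦ e.symm q := by
  have := e.continuousOn_symm
  rwa [F.target_eq e he, continuousOn_univ] at this

/-- **A thin strip around an interior sub-segment misses the leaf arc** (tube lemma).
[folklore] -/
theorem exists_strip (he : e ∈ F.atlas) {c d : ℝ} (hc : D.tlo < c) (hd : d < D.thi) :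
    ∃ δ > 0, ∀ u ∈ Ioo (u₀ - δ) (u₀ + δ), ∀ t ∈ Icc c d, e.symm (u, t) ∉ D.arc '' Icc D.a D.b := by
  set O : Set (ℝ × ℝ) := (fun q : ℝ × ℝ ↦ e.symm q) ⁻¹' (D.arc '' Icc D.a D.b)ᶜ with hO
  have hOo : IsOpen O := ((isCompact_Icc.image D.continuous_arc).isClosed.isOpen_compl).preimage (continuous_symm he)
  have hsub : ({u₀} : Set ℝ) ×ˢ Icc c d ⊆ O := by
    rintro ⟨u, t⟩ ⟨hu, ht⟩
    have hu' : u = u₀ := hu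
    have ht' : t ∈ Icc c d := ht
    rw [hu']
    exact D.vert_not_mem_arc he ⟨hc.trans_le ht'.1, ht'.2.trans_lt hd⟩
  obtain ⟨U, V, hUo, -, hU, hV, hUV⟩ := generalized_tube_lemma isCompact_singleton isCompact_Icc hOo hsub
  obtain ⟨δ, hδ, hball⟩ := Metric.isOpen_iff.1 hUo u₀ (hU rfl)
  refine ⟨δ, hδ, fun u hu t ht hmem ↦ ?_⟩
  have huU : u ∈ U := hball (by rw [Metric.mem_ball, Real.dist_eq, abs_lt]; constructor <;> linarith [hu.1, hu.2])
  exact hUV ⟨huU, hV ht⟩ hmem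

/-- Points off the vertical are not on the vertical segment. [folklore] -/
theorem symm_not_mem_vert (he : e ∈ F.atlas) {u t : ℝ} (hu : u ≠ u₀) : e.symm (u, t) ∉ vert e u₀ '' uIcc D.t₂ D.t₁ := by
  rintro ⟨t', -, h⟩
  have := congrArg e h
  simp only [vert] at this
  rw [e.right_inv (by rw [F.target_eq e he]; exact mem_univ _),
    e.right_inv (by rw [F.target_eq e he]; exact mem_univ _)] at this
  exact hu (Prod.ext_iff.1 this).1.symm

/-- Points of a thin strip off the vertical are off the sack boundary. [folklore] -/
theorem symm_not_mem_traceX (he : e ∈ F.atlas) {u t : ℝ} (hu : u ≠ u₀) (harc : e.symm (u, t) ∉ D.arc '' Icc D.a D.b) :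
    e.symm (u, t) ∉ D.traceX := by
  rintro (h | h)
  · exact harc h
  · exact D.symm_not_mem_vert he hu h

variable {ι : X → ℂ}

/-- The image of a set off the boundary is off the curve. [folklore] -/
theorem image_subset_compl (hιi : Injective ι) {S : Set X} (hS : Disjoint S D.traceX) : ι '' S ⊆ (ι '' D.traceX)ᶜ := by
  rintro _ ⟨y, hy, rfl⟩ ⟨y', hy', h⟩
  exact Set.disjoint_left.1 hS hy (hιi h ▸ hy')

omit [T2Space X] [SecondCountableTopology X] [NoncompactSpace (F.Leaf x)] in
/-- **The strip pieces are preconnected**: images of products of intervals. [folklore] -/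
theorem isPreconnected_image_strip (he : e ∈ F.atlas) (hιc : Continuous ι) {I J : Set ℝ} (hI : IsPreconnected I)
    (hJ : IsPreconnected J) : IsPreconnected (ι '' ((fun q : ℝ × ℝ ↦ e.symm q) '' (I ×ˢ J))) :=
  ((hI.prod hJ).image _ (continuous_symm he).continuousOn).image _ hιc.continuousOn

/-- The midheight of the segment. [folklore] -/
def tmid : ℝ := (D.tlo + D.thi) / 2

/-- The midheight is interior. [folklore] -/
theorem tmid_mem : D.tmid ∈ Ioo D.tlo D.thi := by
  have := D.tlo_lt_thi
  simp only [tmid, mem_Ioo]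
  constructor <;> linarith

/-- A strip width at midheight. [folklore] -/
theorem exists_delta_mid (he : e ∈ F.atlas) :
    ∃ δ > 0, ∀ u ∈ Ioo (u₀ - δ) (u₀ + δ), ∀ t ∈ Icc D.tmid D.tmid, e.symm (u, t) ∉ D.arc '' Icc D.a D.b :=
  D.exists_strip he D.tmid_mem.1 D.tmid_mem.2

/-- The chosen strip width at midheight. [folklore] -/
def δ₀ (he : e ∈ F.atlas) : ℝ := (D.exists_delta_mid he).choose

/-- The chosen strip width is positive. [folklore] -/
theorem δ₀_pos (he : e ∈ F.atlas) : 0 < D.δ₀ he := (D.exists_delta_mid he).choose_spec.1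

/-- The chosen strip misses the arc at midheight. [folklore] -/
theorem δ₀_spec (he : e ∈ F.atlas) :
    ∀ u ∈ Ioo (u₀ - D.δ₀ he) (u₀ + D.δ₀ he), e.symm (u, D.tmid) ∉ D.arc '' Icc D.a D.b := fun u hu ↦
  (D.exists_delta_mid he).choose_spec.2 u hu D.tmid ⟨le_rfl, le_rfl⟩

/-- **The right side** of the sack boundary: the component of the complement of the curve
containing the points just right of the vertical segment. [folklore] -/
def rightSide (he : e ∈ F.atlas) (ι : X → ℂ) : Set ℂ :=
  connectedComponentIn (ι '' D.traceX)ᶜ (ι (e.symm (u₀ + D.δ₀ he / 2, D.tmid)))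

/-- **The left side** of the sack boundary. [folklore] -/
def leftSide (he : e ∈ F.atlas) (ι : X → ℂ) : Set ℂ :=
  connectedComponentIn (ι '' D.traceX)ᶜ (ι (e.symm (u₀ - D.δ₀ he / 2, D.tmid)))

/-- **Points just right of an interior point of the segment lie in the right side.**
[folklore] -/
theorem eventually_mem_rightSide (he : e ∈ F.atlas) (hιc : Continuous ι) (hιi : Injective ι) {t₀ : ℝ}
    (ht₀ : t₀ ∈ Ioo D.tlo D.thi) :
    ∃ δ > 0, ∀ u ∈ Ioo u₀ (u₀ + δ), ι (e.symm (u, t₀)) ∈ D.rightSide he ι := by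
  have hmid := D.tmid_mem
  obtain ⟨δ₁, hδ₁, hstrip⟩ := D.exists_strip he (c := min D.tmid t₀) (d := max D.tmid t₀)
    (lt_min hmid.1 ht₀.1) (max_lt hmid.2 ht₀.2)
  set δ := min (D.δ₀ he) δ₁ with hδ
  have hδpos : 0 < δ := lt_min (D.δ₀_pos he) hδ₁
  refine ⟨δ, hδpos, fun u hu ↦ ?_⟩
  -- the strip `(u₀, u₀ + δ₁) × [min, max]` is preconnected, off the curve, and contains a point
  -- `(u', tmid)` joined to the centre of `rightSide` by the horizontal segment at height `tmid`
  set u' := u₀ + δ / 2 with hu'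
  have hu'₁ : u' ∈ Ioo u₀ (u₀ + δ₁) := ⟨by rw [hu']; linarith, by rw [hu']; linarith [min_le_right (D.δ₀ he) δ₁]⟩
  have hu'₀ : u' ∈ Ioo u₀ (u₀ + D.δ₀ he) := ⟨by rw [hu']; linarith, by rw [hu']; linarith [min_le_left (D.δ₀ he) δ₁]⟩
  -- (1) the centre and `(u', tmid)` are in the same component: horizontal segment at `tmid`
  have h1 : ι (e.symm (u', D.tmid)) ∈ D.rightSide he ι := by
    set H := ι '' ((fun q : ℝ × ℝ ↦ e.symm q) '' (Ioo u₀ (u₀ + D.δ₀ he) ×ˢ ({D.tmid} : Set ℝ))) with hH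
    have hHc : IsPreconnected H := isPreconnected_image_strip he hιc isPreconnected_Ioo isPreconnected_singleton
    have hHsub : H ⊆ (ι '' D.traceX)ᶜ := by
      refine D.image_subset_compl hιi (Set.disjoint_left.2 ?_)
      rintro _ ⟨⟨v, s'⟩, ⟨hv, hs'⟩, rfl⟩ hmem
      have hs'' : s' = D.tmid := hs'
      have hv' : v ∈ Ioo u₀ (u₀ + D.δ₀ he) := hv
      rw [hs''] at hmem
      exact D.symm_not_mem_traceX he (ne_of_gt hv'.1) (D.δ₀_spec he v ⟨by linarith [hv'.1, D.δ₀_pos he], hv'.2⟩) hmem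
    have hcen : ι (e.symm (u₀ + D.δ₀ he / 2, D.tmid)) ∈ H :=
      ⟨_, ⟨(u₀ + D.δ₀ he / 2, D.tmid), ⟨⟨by linarith [D.δ₀_pos he], by linarith [D.δ₀_pos he]⟩, rfl⟩, rfl⟩, rfl⟩
    have hu'H : ι (e.symm (u', D.tmid)) ∈ H := ⟨_, ⟨(u', D.tmid), ⟨hu'₀, rfl⟩, rfl⟩, rfl⟩
    exact (hHc.subset_connectedComponentIn hcen hHsub) hu'H
  -- (2) the strip through `(u', tmid)` and `(u, t₀)`
  set S := ι '' ((fun q : ℝ × ℝ ↦ e.symm q) '' (Ioo u₀ (u₀ + δ₁) ×ˢ Icc (min D.tmid t₀) (max D.tmid t₀))) with hS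
  have hSc : IsPreconnected S := isPreconnected_image_strip he hιc isPreconnected_Ioo isPreconnected_Icc
  have hSsub : S ⊆ (ι '' D.traceX)ᶜ := by
    refine D.image_subset_compl hιi (Set.disjoint_left.2 ?_)
    rintro _ ⟨⟨v, t⟩, ⟨hv, ht⟩, rfl⟩ hmem
    have hv' : v ∈ Ioo u₀ (u₀ + δ₁) := hv
    exact D.symm_not_mem_traceX he (ne_of_gt hv'.1) (hstrip v ⟨by linarith [hv'.1], hv'.2⟩ t ht) hmem
  have hu'S : ι (e.symm (u', D.tmid)) ∈ S := ⟨_, ⟨(u', D.tmid), ⟨hu'₁, min_le_left _ _, le_max_left _ _⟩, rfl⟩, rfl⟩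
  have huS : ι (e.symm (u, t₀)) ∈ S :=
    ⟨_, ⟨(u, t₀), ⟨⟨hu.1, hu.2.trans_le (by linarith [min_le_right (D.δ₀ he) δ₁])⟩, min_le_right _ _, le_max_right _ _⟩,
      rfl⟩, rfl⟩
  have key := hSc.subset_connectedComponentIn hu'S hSsub huS
  rw [rightSide, connectedComponentIn_eq h1]
  exact key

/-- **Points just left of an interior point of the segment lie in the left side.** [folklore] -/
theorem eventually_mem_leftSide (he : e ∈ F.atlas) (hιc : Continuous ι) (hιi : Injective ι) {t₀ : ℝ}
    (ht₀ : t₀ ∈ Ioo D.tlo D.thi) :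
    ∃ δ > 0, ∀ u ∈ Ioo (u₀ - δ) u₀, ι (e.symm (u, t₀)) ∈ D.leftSide he ι := by
  have hmid := D.tmid_mem
  obtain ⟨δ₁, hδ₁, hstrip⟩ := D.exists_strip he (c := min D.tmid t₀) (d := max D.tmid t₀)
    (lt_min hmid.1 ht₀.1) (max_lt hmid.2 ht₀.2)
  set δ := min (D.δ₀ he) δ₁ with hδ
  have hδpos : 0 < δ := lt_min (D.δ₀_pos he) hδ₁
  refine ⟨δ, hδpos, fun u hu ↦ ?_⟩
  set u' := u₀ - δ / 2 with hu'
  have hu'₁ : u' ∈ Ioo (u₀ - δ₁) u₀ := ⟨by rw [hu']; linarith [min_le_right (D.δ₀ he) δ₁], by rw [hu']; linarith⟩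
  have hu'₀ : u' ∈ Ioo (u₀ - D.δ₀ he) u₀ := ⟨by rw [hu']; linarith [min_le_left (D.δ₀ he) δ₁], by rw [hu']; linarith⟩
  have h1 : ι (e.symm (u', D.tmid)) ∈ D.leftSide he ι := by
    set H := ι '' ((fun q : ℝ × ℝ ↦ e.symm q) '' (Ioo (u₀ - D.δ₀ he) u₀ ×ˢ ({D.tmid} : Set ℝ))) with hH
    have hHc : IsPreconnected H := isPreconnected_image_strip he hιc isPreconnected_Ioo isPreconnected_singleton
    have hHsub : H ⊆ (ι '' D.traceX)ᶜ := by
      refine D.image_subset_compl hιi (Set.disjoint_left.2 ?_)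
      rintro _ ⟨⟨v, s'⟩, ⟨hv, hs'⟩, rfl⟩ hmem
      have hs'' : s' = D.tmid := hs'
      have hv' : v ∈ Ioo (u₀ - D.δ₀ he) u₀ := hv
      rw [hs''] at hmem
      exact D.symm_not_mem_traceX he (ne_of_lt hv'.2) (D.δ₀_spec he v ⟨hv'.1, by linarith [hv'.2, D.δ₀_pos he]⟩) hmem
    have hcen : ι (e.symm (u₀ - D.δ₀ he / 2, D.tmid)) ∈ H :=
      ⟨_, ⟨(u₀ - D.δ₀ he / 2, D.tmid), ⟨⟨by linarith [D.δ₀_pos he], by linarith [D.δ₀_pos he]⟩, rfl⟩, rfl⟩, rfl⟩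
    have hu'H : ι (e.symm (u', D.tmid)) ∈ H := ⟨_, ⟨(u', D.tmid), ⟨hu'₀, rfl⟩, rfl⟩, rfl⟩
    exact (hHc.subset_connectedComponentIn hcen hHsub) hu'H
  set S := ι '' ((fun q : ℝ × ℝ ↦ e.symm q) '' (Ioo (u₀ - δ₁) u₀ ×ˢ Icc (min D.tmid t₀) (max D.tmid t₀))) with hS
  have hSc : IsPreconnected S := isPreconnected_image_strip he hιc isPreconnected_Ioo isPreconnected_Icc
  have hSsub : S ⊆ (ι '' D.traceX)ᶜ := by
    refine D.image_subset_compl hιi (Set.disjoint_left.2 ?_)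
    rintro _ ⟨⟨v, t⟩, ⟨hv, ht⟩, rfl⟩ hmem
    have hv' : v ∈ Ioo (u₀ - δ₁) u₀ := hv
    exact D.symm_not_mem_traceX he (ne_of_lt hv'.2) (hstrip v ⟨hv'.1, by linarith [hv'.2]⟩ t ht) hmem
  have hu'S : ι (e.symm (u', D.tmid)) ∈ S := ⟨_, ⟨(u', D.tmid), ⟨hu'₁, min_le_left _ _, le_max_left _ _⟩, rfl⟩, rfl⟩
  have huS : ι (e.symm (u, t₀)) ∈ S :=
    ⟨_, ⟨(u, t₀), ⟨⟨hu.1.trans_le' (by linarith [min_le_right (D.δ₀ he) δ₁]), hu.2⟩, min_le_right _ _, le_max_right _ _⟩,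
      rfl⟩, rfl⟩
  have key := hSc.subset_connectedComponentIn hu'S hSsub huS
  rw [leftSide, connectedComponentIn_eq h1]
  exact key

/-- **The two sides are different components** of the complement of the sack boundary. Both
Jordan components have the curve as frontier, so each meets every small box around the interior
point `e⁻¹ (u₀, tmid)` of the segment; such a box minus the curve is the union of its right half
(in the right side) and its left half (in the left side); if the two sides coincided, both Jordan
components would be that one component. [folklore] -/
theorem rightSide_ne_leftSide (he : e ∈ F.atlas) (hι : IsOpenEmbedding ι) : D.rightSide he ι ≠ D.leftSide he ι := by
  have hιc := hι.continuous
  have hιi := hι.injective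
  intro hEq
  obtain ⟨z, w, hz, hw, hne, hcover, hfz, hfw⟩ := D.jordan he hιc hιi
  have hmid := D.tmid_mem
  -- a box around `(u₀, tmid)` missing the arc
  obtain ⟨η, hη, hηI⟩ : ∃ η > 0, Icc (D.tmid - η) (D.tmid + η) ⊆ Ioo D.tlo D.thi := by
    refine ⟨min (D.tmid - D.tlo) (D.thi - D.tmid) / 2, by
      have := lt_min (sub_pos.2 hmid.1) (sub_pos.2 hmid.2); linarith, fun t ht ↦ ⟨?_, ?_⟩⟩
    · linarith [ht.1, min_le_left (D.tmid - D.tlo) (D.thi - D.tmid), hmid.1, hmid.2]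
    · linarith [ht.2, min_le_right (D.tmid - D.tlo) (D.thi - D.tmid), hmid.1, hmid.2]
  obtain ⟨δ₁, hδ₁, hstrip⟩ := D.exists_strip he (c := D.tmid - η) (d := D.tmid + η) (hηI ⟨le_rfl, by linarith⟩).1
    (hηI ⟨by linarith, le_rfl⟩).2
  obtain ⟨δr, hδr, hright⟩ := D.eventually_mem_rightSide he hιc hιi hmid
  obtain ⟨δl, hδl, hleft⟩ := D.eventually_mem_leftSide he hιc hιi hmid
  set δ := min δ₁ η with hδ
  have hδpos : 0 < δ := lt_min hδ₁ hη
  -- the open box `N` and its two halves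
  set box : Set (ℝ × ℝ) := Ioo (u₀ - δ) (u₀ + δ) ×ˢ Ioo (D.tmid - δ) (D.tmid + δ) with hbox
  set N : Set ℂ := ι '' ((fun q : ℝ × ℝ ↦ e.symm q) '' box) with hN
  have hNo : IsOpen N := by
    refine hι.isOpenMap _ ?_
    have : (fun q : ℝ × ℝ ↦ e.symm q) '' box = e.symm '' box := rfl
    rw [this]
    exact e.symm.isOpen_image_of_subset_source (isOpen_Ioo.prod isOpen_Ioo)
      (by rw [e.symm_source, F.target_eq e he]; exact subset_univ _)
  have hcN : ι (vert e u₀ D.tmid) ∈ N :=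
    ⟨_, ⟨(u₀, D.tmid), ⟨⟨by linarith, by linarith⟩, by linarith, by linarith⟩, rfl⟩, rfl⟩
  have hcC : ι (vert e u₀ D.tmid) ∈ ι '' D.traceX :=
    mem_image_of_mem ι (Or.inr ⟨D.tmid, by rw [D.uIcc_eq]; exact ⟨hmid.1.le, hmid.2.le⟩, rfl⟩)
  -- a point of `N` off the curve is in the right or the left side
  have hNside : ∀ v ∈ N, v ∉ ι '' D.traceX → v ∈ D.rightSide he ι ∨ v ∈ D.leftSide he ι := by
    rintro _ ⟨_, ⟨⟨u, t⟩, ⟨hu, ht⟩, rfl⟩, rfl⟩ hv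
    have hune : u ≠ u₀ := by
      rintro rfl
      exact hv (mem_image_of_mem ι (Or.inr ⟨t, by
        rw [D.uIcc_eq]; exact ⟨(hηI ⟨by linarith [ht.1, min_le_right δ₁ η], by linarith [ht.2, min_le_right δ₁ η]⟩).1.le,
          (hηI ⟨by linarith [ht.1, min_le_right δ₁ η], by linarith [ht.2, min_le_right δ₁ η]⟩).2.le⟩, rfl⟩))
    have htI : t ∈ Ioo D.tlo D.thi := hηI ⟨by linarith [ht.1, min_le_right δ₁ η], by linarith [ht.2, min_le_right δ₁ η]⟩
    rcases lt_or_gt_of_ne hune with hlt | hgt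
    · -- left half: connect `(u, t)` to `(u', tmid)` inside the left half-box (preconnected, off the curve)
      right
      obtain ⟨δl', hδl', hleft'⟩ := D.eventually_mem_leftSide he hιc hιi htI
      set H := ι '' ((fun q : ℝ × ℝ ↦ e.symm q) '' (Ioo (u₀ - δ) u₀ ×ˢ ({t} : Set ℝ))) with hH
      have hHc : IsPreconnected H := isPreconnected_image_strip he hιc isPreconnected_Ioo isPreconnected_singleton
      have hHsub : H ⊆ (ι '' D.traceX)ᶜ := by
        refine D.image_subset_compl hιi (Set.disjoint_left.2 ?_)
        rintro _ ⟨⟨v', s'⟩, ⟨hv', hs'⟩, rfl⟩ hmem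
        have hs't : s' = t := hs'
        have hv'' : v' ∈ Ioo (u₀ - δ) u₀ := hv'
        rw [hs't] at hmem
        exact D.symm_not_mem_traceX he (ne_of_lt hv''.2)
          (hstrip v' ⟨by linarith [hv''.1, min_le_left δ₁ η], by linarith [hv''.2]⟩ t
            ⟨by linarith [ht.1, min_le_right δ₁ η], by linarith [ht.2, min_le_right δ₁ η]⟩) hmem
      set u' := u₀ - min δ δl' / 2 with hu'
      have hu'mem : ι (e.symm (u', t)) ∈ D.leftSide he ι :=
        hleft' u' ⟨by rw [hu']; linarith [min_le_right δ δl'], by rw [hu']; linarith [lt_min hδpos hδl']⟩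
      have hu'H : ι (e.symm (u', t)) ∈ H :=
        ⟨_, ⟨(u', t), ⟨⟨by rw [hu']; linarith [min_le_left δ δl'], by rw [hu']; linarith [lt_min hδpos hδl']⟩, rfl⟩,
          rfl⟩, rfl⟩
      have huH : ι (e.symm (u, t)) ∈ H := ⟨_, ⟨(u, t), ⟨⟨hu.1, hlt⟩, rfl⟩, rfl⟩, rfl⟩
      have key := hHc.subset_connectedComponentIn hu'H hHsub huH
      rw [leftSide] at hu'mem ⊢
      rwa [connectedComponentIn_eq hu'mem]
    · left
      obtain ⟨δr', hδr', hright'⟩ := D.eventually_mem_rightSide he hιc hιi htI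
      set H := ι '' ((fun q : ℝ × ℝ ↦ e.symm q) '' (Ioo u₀ (u₀ + δ) ×ˢ ({t} : Set ℝ))) with hH
      have hHc : IsPreconnected H := isPreconnected_image_strip he hιc isPreconnected_Ioo isPreconnected_singleton
      have hHsub : H ⊆ (ι '' D.traceX)ᶜ := by
        refine D.image_subset_compl hιi (Set.disjoint_left.2 ?_)
        rintro _ ⟨⟨v', s'⟩, ⟨hv', hs'⟩, rfl⟩ hmem
        have hs't : s' = t := hs'
        have hv'' : v' ∈ Ioo u₀ (u₀ + δ) := hv'
        rw [hs't] at hmem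
        exact D.symm_not_mem_traceX he (ne_of_gt hv''.1)
          (hstrip v' ⟨by linarith [hv''.1], by linarith [hv''.2, min_le_left δ₁ η]⟩ t
            ⟨by linarith [ht.1, min_le_right δ₁ η], by linarith [ht.2, min_le_right δ₁ η]⟩) hmem
      set u' := u₀ + min δ δr' / 2 with hu'
      have hu'mem : ι (e.symm (u', t)) ∈ D.rightSide he ι :=
        hright' u' ⟨by rw [hu']; linarith [lt_min hδpos hδr'], by rw [hu']; linarith [min_le_right δ δr']⟩
      have hu'H : ι (e.symm (u', t)) ∈ H :=
        ⟨_, ⟨(u', t), ⟨⟨by rw [hu']; linarith [lt_min hδpos hδr'], by rw [hu']; linarith [min_le_left δ δr']⟩, rfl⟩,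
          rfl⟩, rfl⟩
      have huH : ι (e.symm (u, t)) ∈ H := ⟨_, ⟨(u, t), ⟨⟨hgt, hu.2⟩, rfl⟩, rfl⟩, rfl⟩
      have key := hHc.subset_connectedComponentIn hu'H hHsub huH
      rw [rightSide] at hu'mem ⊢
      rwa [connectedComponentIn_eq hu'mem]
  -- each Jordan component meets `N` off the curve, hence is the right or the left side
  have hmeet : ∀ y : ℂ, frontier (connectedComponentIn (ι '' D.traceX)ᶜ y) = ι '' D.traceX →
      connectedComponentIn (ι '' D.traceX)ᶜ y = D.rightSide he ι ∨
        connectedComponentIn (ι '' D.traceX)ᶜ y = D.leftSide he ι := by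
    intro y hfy
    have hcl : ι (vert e u₀ D.tmid) ∈ closure (connectedComponentIn (ι '' D.traceX)ᶜ y) :=
      frontier_subset_closure (hfy.symm ▸ hcC)
    obtain ⟨v, hvN, hvy⟩ := mem_closure_iff_nhds.1 hcl N (hNo.mem_nhds hcN)
    have hvC : v ∉ ι '' D.traceX := fun h ↦ (connectedComponentIn_subset _ _ hvy) h
    rcases hNside v hvN hvC with h | h
    · left
      rw [rightSide] at h ⊢
      rw [connectedComponentIn_eq hvy, ← connectedComponentIn_eq h]
    · right
      rw [leftSide] at h ⊢
      rw [connectedComponentIn_eq hvy, ← connectedComponentIn_eq h]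
  have hz' := hmeet z hfz
  have hw' := hmeet w hfw
  rw [← hEq] at hz' hw'
  simp only [or_self] at hz' hw'
  exact hne (hz'.trans hw'.symm)

/-! ### The corner at `p₂`: the forward plaque enters the right side -/

/-- Near its end `p₂`, the leaf arc lies on the plaque through `p₂`, to the left of the
vertical: there is `ε > 0` such that the points `arc s`, `s ∈ (b - ε, b]`, are in the box `e` at
height `t₂` with leaf coordinate `≤ u₀` (crossings are left to right). [folklore] -/
theorem exists_eps_arc_end (he : e ∈ F.atlas) :
    ∃ ε > 0, ∀ s ∈ Ioc (D.b - ε) D.b, D.arc s ∈ e.source ∧ (e (D.arc s)).2 = D.t₂ ∧ (e (D.arc s)).1 ≤ u₀ := by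
  have hev := eventually_leafLT_iff_lt_fst (hbi := hbi) he D.cross₂
  -- pull back along the continuous map `s ↦ g.symm s` at `s = b`
  have hcont : ContinuousAt (fun s : ℝ ↦ D.g.symm s) D.b := (arc_continuousAt_symm D.g_target D.b)
  have hgb : D.g.symm D.b = D.p₂ := by rw [b, D.g.left_inv D.p₂_mem]
  rw [← hgb] at hev
  have hev' := hcont.eventually hev
  obtain ⟨ε, hε, hball⟩ := Metric.eventually_nhds_iff.1 hev'
  refine ⟨ε, hε, fun s hs ↦ ?_⟩
  have hsb : dist s D.b < ε := by rw [Real.dist_eq, abs_lt]; constructor <;> linarith [hs.1, hs.2]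
  obtain ⟨hsrc, hht, hlt, hgt⟩ := hball hsb
  refine ⟨hsrc, hht.trans (by rw [hgb]; rfl), ?_⟩
  -- `g.symm s ≤ p₂` in the leaf, so it is not to the right of the vertical
  by_contra hpos
  push Not at hpos
  rw [hgb] at hlt
  have hps : leafLT hbi D.p₂ (D.g.symm s) := hlt.2 hpos
  have := (leafLT_iff D.p₂_mem (arc_symm_mem D.g_target s)).1 hps
  rw [arc_apply_symm D.g_target] at this
  exact absurd this (not_lt.2 hs.2)

/-- A neighbourhood of `pt p₂` meeting the leaf arc only near its end. [folklore] -/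
theorem exists_nhds_arc_end (he : e ∈ F.atlas) {ε : ℝ} (hε : 0 < ε) :
    ∃ η > 0, ∀ u ∈ Ioo (u₀ - η) (u₀ + η), ∀ t ∈ Ioo (D.t₂ - η) (D.t₂ + η), ∀ s ∈ Icc D.a D.b,
      e.symm (u, t) = D.arc s → s ∈ Ioc (D.b - ε) D.b := by
  -- the initial piece `arc '' [a, b - ε]` is compact and misses `pt p₂`
  set K' := D.arc '' Icc D.a (D.b - ε) with hK'
  have hK'c : IsCompact K' := isCompact_Icc.image D.continuous_arc
  have hp₂ : Leaf.pt D.p₂ ∉ K' := by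
    rintro ⟨s, hs, hsb⟩
    rw [← D.arc_b] at hsb
    have := D.injective_arc hsb
    linarith [hs.2]
  have hO : IsOpen ((fun q : ℝ × ℝ ↦ e.symm q) ⁻¹' K'ᶜ) := hK'c.isClosed.isOpen_compl.preimage (continuous_symm he)
  have hmem : (u₀, D.t₂) ∈ (fun q : ℝ × ℝ ↦ e.symm q) ⁻¹' K'ᶜ := by
    show e.symm (u₀, D.t₂) ∉ K'
    rw [show e.symm (u₀, D.t₂) = vert e u₀ D.t₂ from rfl, D.vert_t₂]
    exact hp₂
  obtain ⟨η, hη, hball⟩ := Metric.isOpen_iff.1 hO _ hmem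
  refine ⟨η, hη, fun u hu t ht s hs hEq ↦ ?_⟩
  have hin : (u, t) ∈ Metric.ball (u₀, D.t₂) η := by
    rw [Metric.mem_ball, Prod.dist_eq, max_lt_iff, Real.dist_eq, Real.dist_eq, abs_lt, abs_lt]
    exact ⟨⟨by linarith [hu.1], by linarith [hu.2]⟩, ⟨by linarith [ht.1], by linarith [ht.2]⟩⟩
  have hnot : e.symm (u, t) ∉ K' := hball hin
  refine ⟨?_, hs.2⟩
  by_contra hle
  push Not at hle
  exact hnot ⟨s, ⟨hs.1, hle⟩, hEq.symm⟩

/-- **The forward plaque at `p₂` enters the right side**: the points `e⁻¹ (u, t₂)` with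
`u₀ < u < u₀ + η` are in the right side of the sack boundary. Near `pt p₂` the curve consists of
the vertical below/above `p₂` and the plaque to the LEFT of `u₀`; the right part of a small box
between the height `t₂` and a nearby interior height is connected, misses the curve and
reaches points known to be in the right side. [folklore] -/
theorem exists_forward_mem_rightSide (he : e ∈ F.atlas) (hιc : Continuous ι) (hιi : Injective ι) :
    ∃ η > 0, ∀ u ∈ Ioo u₀ (u₀ + η), ι (e.symm (u, D.t₂)) ∈ D.rightSide he ι := by
  obtain ⟨ε, hε, harcend⟩ := D.exists_eps_arc_end he
  obtain ⟨η₁, hη₁, hnear⟩ := D.exists_nhds_arc_end he hε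
  have hgap : 0 < D.thi - D.tlo := sub_pos.2 D.tlo_lt_thi
  set η := min η₁ ((D.thi - D.tlo) / 2) with hη
  have hηpos : 0 < η := lt_min hη₁ (by linarith)
  have hη₁' : η ≤ η₁ := min_le_left _ _
  -- an interior height `t₀` next to `t₂`, inside the box
  obtain ⟨t₀, ht₀I, ht₀near⟩ : ∃ t₀, t₀ ∈ Ioo D.tlo D.thi ∧ t₀ ∈ Ioo (D.t₂ - η) (D.t₂ + η) := by
    have hη2 : η ≤ (D.thi - D.tlo) / 2 := min_le_right _ _
    rcases le_total D.t₁ D.t₂ with h | h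
    · -- `t₂ = thi`: go down
      have ht₂ : D.thi = D.t₂ := max_eq_right h
      refine ⟨D.t₂ - η / 2, ⟨?_, ?_⟩, ?_, ?_⟩
      · rw [ht₂] at hgap hη2; linarith
      · rw [ht₂]; linarith
      · linarith
      · linarith
    · -- `t₂ = tlo`: go up
      have ht₂ : D.tlo = D.t₂ := min_eq_right h
      refine ⟨D.t₂ + η / 2, ⟨?_, ?_⟩, ?_, ?_⟩
      · rw [ht₂]; linarith
      · rw [ht₂] at hgap hη2; linarith
      · linarith
      · linarith
  obtain ⟨δ, hδ, hright⟩ := D.eventually_mem_rightSide he hιc hιi ht₀I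
  refine ⟨min η δ, lt_min hηpos hδ, fun u hu ↦ ?_⟩
  have huη : u ∈ Ioo u₀ (u₀ + η) := ⟨hu.1, hu.2.trans_le (by linarith [min_le_left η δ])⟩
  -- the right part of the box between the heights `t₀` and `t₂`
  set Q := ι '' ((fun q : ℝ × ℝ ↦ e.symm q) '' (Ioo u₀ (u₀ + η) ×ˢ Icc (min t₀ D.t₂) (max t₀ D.t₂))) with hQ
  have hQc : IsPreconnected Q := isPreconnected_image_strip he hιc isPreconnected_Ioo isPreconnected_Icc
  have hQsub : Q ⊆ (ι '' D.traceX)ᶜ := by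
    refine D.image_subset_compl hιi (Set.disjoint_left.2 ?_)
    rintro _ ⟨⟨v, t⟩, ⟨hv, ht⟩, rfl⟩ hmem
    have hv' : v ∈ Ioo u₀ (u₀ + η) := hv
    have ht' : t ∈ Icc (min t₀ D.t₂) (max t₀ D.t₂) := ht
    have htnear : t ∈ Ioo (D.t₂ - η) (D.t₂ + η) := by
      constructor
      · exact lt_of_lt_of_le (lt_min ht₀near.1 (by linarith)) ht'.1
      · exact lt_of_le_of_lt ht'.2 (max_lt ht₀near.2 (by linarith))
    refine D.symm_not_mem_traceX he (ne_of_gt hv'.1) ?_ hmem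
    rintro ⟨s, hs, hsEq⟩
    have hsI := hnear v ⟨by linarith [hv'.1], by linarith [hv'.2]⟩ t ⟨by linarith [htnear.1], by linarith [htnear.2]⟩
      s hs hsEq.symm
    obtain ⟨hsrc, -, hle⟩ := harcend s hsI
    -- the leaf coordinate of `arc s = e.symm (v, t)` is `v > u₀`
    have : (e (D.arc s)).1 = v := by
      rw [hsEq, e.right_inv (by rw [F.target_eq e he]; exact mem_univ _)]
    linarith [hv'.1]
  have hcorner : ι (e.symm (u, D.t₂)) ∈ Q :=
    ⟨_, ⟨(u, D.t₂), ⟨huη, min_le_right _ _, le_max_right _ _⟩, rfl⟩, rfl⟩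
  set u' := u₀ + min η δ / 2 with hu'
  have hu'Q : ι (e.symm (u', t₀)) ∈ Q :=
    ⟨_, ⟨(u', t₀), ⟨⟨by rw [hu']; linarith [lt_min hηpos hδ], by rw [hu']; linarith [min_le_left η δ]⟩,
      min_le_left _ _, le_max_left _ _⟩, rfl⟩, rfl⟩
  have hu'R : ι (e.symm (u', t₀)) ∈ D.rightSide he ι :=
    hright u' ⟨by rw [hu']; linarith [lt_min hηpos hδ], by rw [hu']; linarith [min_le_right η δ]⟩
  have key := hQc.subset_connectedComponentIn hu'Q hQsub hcorner
  rw [rightSide] at hu'R ⊢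
  rwa [connectedComponentIn_eq hu'R]

/-! ### The Bendixson sack lemma -/

omit [T2Space X] [SecondCountableTopology X] [NoncompactSpace (F.Leaf x)] in
/-- The point of the leaf read in the box `e` (when in its source). [folklore] -/
theorem pt_eq_symm {q : F.Leaf x} (hq : Leaf.pt q ∈ e.source) :
    Leaf.pt q = e.symm ((e (Leaf.pt q)).1, ht e q) := by
  rw [show ((e (Leaf.pt q)).1, ht e q) = e (Leaf.pt q) from rfl, e.left_inv hq]

/-- **Just after `p₂`, the leaf is in the right side.** [folklore] -/
theorem eventually_mem_rightSide_after (he : e ∈ F.atlas) (hιc : Continuous ι) (hιi : Injective ι) :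
    ∀ᶠ q in 𝓝 D.p₂, leafLT hbi D.p₂ q → ι (Leaf.pt q) ∈ D.rightSide he ι := by
  obtain ⟨η, hη, hforward⟩ := D.exists_forward_mem_rightSide he hιc hιi
  have hev := eventually_leafLT_iff_lt_fst (hbi := hbi) he D.cross₂
  have hca : ContinuousAt (fun q : F.Leaf x ↦ (e (Leaf.pt q)).1) D.p₂ :=
    continuous_fst.continuousAt.comp ((e.continuousAt D.cross₂.1).comp (Leaf.continuous_coe F x).continuousAt)
  have hlt : ∀ᶠ q in 𝓝 D.p₂, (e (Leaf.pt q)).1 < u₀ + η := by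
    have h0 : (fun q : F.Leaf x ↦ (e (Leaf.pt q)).1) D.p₂ < u₀ + η := by
      show (e (Leaf.pt D.p₂)).1 < u₀ + η
      rw [D.cross₂.2]; linarith
    exact hca.eventually (Iio_mem_nhds h0)
  filter_upwards [hev, hlt] with q hq hqlt hpq
  obtain ⟨hsrc, hht, hiff, -⟩ := hq
  have hu : u₀ < (e (Leaf.pt q)).1 := hiff.1 hpq
  rw [pt_eq_symm hsrc, hht]
  exact hforward _ ⟨hu, hqlt⟩

/-- **Just before a crossing at an interior height, the leaf is in the left side.** [folklore] -/
theorem eventually_mem_leftSide_before (he : e ∈ F.atlas) (hιc : Continuous ι) (hιi : Injective ι) {r : F.Leaf x}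
    (hr : IsCrossing e u₀ r) (hrt : ht e r ∈ Ioo D.tlo D.thi) :
    ∀ᶠ q in 𝓝 r, leafLT hbi q r → ι (Leaf.pt q) ∈ D.leftSide he ι := by
  obtain ⟨δ, hδ, hleft⟩ := D.eventually_mem_leftSide he hιc hιi hrt
  have hev := eventually_leafLT_iff_lt_fst (hbi := hbi) he hr
  have hca : ContinuousAt (fun q : F.Leaf x ↦ (e (Leaf.pt q)).1) r :=
    continuous_fst.continuousAt.comp ((e.continuousAt hr.1).comp (Leaf.continuous_coe F x).continuousAt)
  have hgt : ∀ᶠ q in 𝓝 r, u₀ - δ < (e (Leaf.pt q)).1 := by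
    have h0 : u₀ - δ < (fun q : F.Leaf x ↦ (e (Leaf.pt q)).1) r := by
      show u₀ - δ < (e (Leaf.pt r)).1
      rw [hr.2]; linarith
    exact hca.eventually (Ioi_mem_nhds h0)
  filter_upwards [hev, hgt] with q hq hqgt hqr
  obtain ⟨hsrc, hht, -, hiff⟩ := hq
  have hu : (e (Leaf.pt q)).1 < u₀ := hiff.1 hqr
  rw [pt_eq_symm hsrc, hht]
  exact hleft _ ⟨hqgt, hu⟩

/-- **The Bendixson sack lemma.** After two successive crossings `p₁ < p₂` of the vertical
`u = u₀` of a flow box, an open leaf of a bi-oriented planar foliation never again crosses the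
vertical strictly between them: the leaf enters the right side of the Jordan curve
`[p₁, p₂] ∪ Σ[p₁, p₂]` at `p₂` and could only come back to the segment from the left side.
[folklore] -/
theorem ht_not_mem_Ioo_of_lt (he : e ∈ F.atlas) (hι : IsOpenEmbedding ι) {q : F.Leaf x} (hq : leafLT hbi D.p₂ q)
    (hcr : IsCrossing e u₀ q) : ht e q ∉ Ioo D.tlo D.thi := by
  have hιc := hι.continuous
  have hιi := hι.injective
  intro hqI
  -- the first crossing `r` after `p₂` with height in `[tlo, thi]`
  obtain ⟨r, hp₂r, hrq, hr, hrT, hfirst⟩ :=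
    exists_first_crossing (hbi := hbi) he isClosed_Icc (Metric.isBounded_Icc _ _) hq hcr (Ioo_subset_Icc_self hqI)
  -- its height is interior
  have hrt : ht e r ∈ Ioo D.tlo D.thi := by
    have hne₁ : ht e r ≠ D.t₁ := fun h ↦ by
      have := hr.eq_of_ht_eq D.cross₁ h
      rw [this] at hp₂r
      exact leafLT_asymm D.lt hp₂r
    have hne₂ : ht e r ≠ D.t₂ := fun h ↦ by
      have := hr.eq_of_ht_eq D.cross₂ h
      rw [this] at hp₂r
      exact leafLT_irrefl _ hp₂r
    refine ⟨lt_of_le_of_ne hrT.1 ?_, lt_of_le_of_ne hrT.2 ?_⟩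
    · rw [tlo]; rcases min_choice D.t₁ D.t₂ with h | h <;> rw [h]
      · exact hne₁.symm
      · exact hne₂.symm
    · rw [thi]; rcases max_choice D.t₁ D.t₂ with h | h <;> rw [h]
      · exact hne₁
      · exact hne₂
  -- the open leaf interval `(p₂, r)` maps into the complement of the curve
  set O := leafIoo hbi D.p₂ r with hO
  set S := (fun s : F.Leaf x ↦ ι (Leaf.pt s)) '' O with hS
  have hSc : IsPreconnected S :=
    (isPreconnected_leafIoo D.p₂ r).image _ (hιc.comp (Leaf.continuous_coe F x)).continuousOn
  have hSsub : S ⊆ (ι '' D.traceX)ᶜ := by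
    rintro _ ⟨s, ⟨hs₁, hs₂⟩, rfl⟩ ⟨y, hy, hys⟩
    have hy' : y = Leaf.pt s := hιi hys
    subst hy'
    rcases hy with ⟨σ, hσ, hσs⟩ | ⟨t, htI, hts⟩
    · -- on the leaf arc: `s ∈ [p₁, p₂]`, not after `p₂`
      have hs : D.g.symm σ = s := Leaf.injective_coe F x hσs
      have hsI : s ∈ leafIcc hbi D.p₁ D.p₂ := hs ▸ D.symm_mem_leafIcc hσ
      exact hsI.2 hs₁
    · -- on the vertical segment: a crossing strictly between `p₂` and `r`
      have hsrc : Leaf.pt s ∈ e.source := by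
        rw [← hts]; exact e.map_target (by rw [F.target_eq e he]; exact mem_univ _)
      have hes : e (Leaf.pt s) = (u₀, t) := by
        rw [← hts, vert, e.right_inv (by rw [F.target_eq e he]; exact mem_univ _)]
      refine hfirst s hs₁ hs₂ ⟨⟨hsrc, by rw [hes]⟩, ?_⟩
      rw [show ht e s = (e (Leaf.pt s)).2 from rfl, hes, ← D.uIcc_eq]
      exact htI
  -- a point of `S` in the right side (just after `p₂`) and one in the left side (just before `r`)
  obtain ⟨q₁, hq₁O, hq₁R⟩ : ∃ q₁ ∈ O, ι (Leaf.pt q₁) ∈ D.rightSide he ι := by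
    have hev := ((isOpen_setOf_leafLT_left (hbi := hbi) r).mem_nhds hp₂r)
    have h := (frequently_leafLT_right (hbi := hbi) D.p₂).and_eventually
      ((D.eventually_mem_rightSide_after he hιc hιi).and hev)
    obtain ⟨q₁, hlt, himp, hqr⟩ := h.exists
    exact ⟨q₁, ⟨hlt, hqr⟩, himp hlt⟩
  obtain ⟨q₂, hq₂O, hq₂L⟩ : ∃ q₂ ∈ O, ι (Leaf.pt q₂) ∈ D.leftSide he ι := by
    have hev := ((isOpen_setOf_leafLT_right (hbi := hbi) D.p₂).mem_nhds hp₂r)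
    have h := (frequently_leafLT_left (hbi := hbi) r).and_eventually
      ((D.eventually_mem_leftSide_before he hιc hιi hr hrt).and hev)
    obtain ⟨q₂, hlt, himp, hpq⟩ := h.exists
    exact ⟨q₂, ⟨hpq, hlt⟩, himp hlt⟩
  -- hence the two sides coincide: contradiction
  have h₁ : S ⊆ connectedComponentIn (ι '' D.traceX)ᶜ (ι (Leaf.pt q₁)) :=
    hSc.subset_connectedComponentIn (mem_image_of_mem _ hq₁O) hSsub
  have h₂ : ι (Leaf.pt q₂) ∈ connectedComponentIn (ι '' D.traceX)ᶜ (ι (Leaf.pt q₁)) := h₁ (mem_image_of_mem _ hq₂O)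
  apply D.rightSide_ne_leftSide he hι
  rw [rightSide] at hq₁R ⊢
  rw [leftSide] at hq₂L ⊢
  rw [connectedComponentIn_eq hq₁R, connectedComponentIn_eq h₂, ← connectedComponentIn_eq hq₂L]

/-! ### The corner at `p₁` and the far side of the segment -/

/-- Near its start `p₁`, the leaf arc lies on the plaque through `p₁`, to the right of the
vertical. [folklore] -/
theorem exists_eps_arc_start (he : e ∈ F.atlas) :
    ∃ ε > 0, ∀ s ∈ Ico D.a (D.a + ε), D.arc s ∈ e.source ∧ (e (D.arc s)).2 = D.t₁ ∧ u₀ ≤ (e (D.arc s)).1 := by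
  have hev := eventually_leafLT_iff_lt_fst (hbi := hbi) he D.cross₁
  have hcont : ContinuousAt (fun s : ℝ ↦ D.g.symm s) D.a := (arc_continuousAt_symm D.g_target D.a)
  have hga : D.g.symm D.a = D.p₁ := by rw [a, D.g.left_inv D.p₁_mem]
  rw [← hga] at hev
  have hev' := hcont.eventually hev
  obtain ⟨ε, hε, hball⟩ := Metric.eventually_nhds_iff.1 hev'
  refine ⟨ε, hε, fun s hs ↦ ?_⟩
  have hsa : dist s D.a < ε := by rw [Real.dist_eq, abs_lt]; constructor <;> linarith [hs.1, hs.2]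
  obtain ⟨hsrc, hht, hlt, hgt⟩ := hball hsa
  refine ⟨hsrc, hht.trans (by rw [hga]; rfl), ?_⟩
  by_contra hneg
  push Not at hneg
  rw [hga] at hgt
  have hps : leafLT hbi (D.g.symm s) D.p₁ := hgt.2 hneg
  have := (leafLT_iff (arc_symm_mem D.g_target s) D.p₁_mem).1 hps
  rw [arc_apply_symm D.g_target] at this
  exact absurd this (not_lt.2 hs.1)

/-- A neighbourhood of `pt p₁` meeting the leaf arc only near its start. [folklore] -/
theorem exists_nhds_arc_start (he : e ∈ F.atlas) {ε : ℝ} (hε : 0 < ε) :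
    ∃ η > 0, ∀ u ∈ Ioo (u₀ - η) (u₀ + η), ∀ t ∈ Ioo (D.t₁ - η) (D.t₁ + η), ∀ s ∈ Icc D.a D.b,
      e.symm (u, t) = D.arc s → s ∈ Ico D.a (D.a + ε) := by
  set K' := D.arc '' Icc (D.a + ε) D.b with hK'
  have hK'c : IsCompact K' := isCompact_Icc.image D.continuous_arc
  have hp₁ : Leaf.pt D.p₁ ∉ K' := by
    rintro ⟨s, hs, hsa⟩
    rw [← D.arc_a] at hsa
    have := D.injective_arc hsa
    linarith [hs.1]
  have hO : IsOpen ((fun q : ℝ × ℝ ↦ e.symm q) ⁻¹' K'ᶜ) := hK'c.isClosed.isOpen_compl.preimage (continuous_symm he)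
  have hmem : (u₀, D.t₁) ∈ (fun q : ℝ × ℝ ↦ e.symm q) ⁻¹' K'ᶜ := by
    show e.symm (u₀, D.t₁) ∉ K'
    rw [show e.symm (u₀, D.t₁) = vert e u₀ D.t₁ from rfl, D.vert_t₁]
    exact hp₁
  obtain ⟨η, hη, hball⟩ := Metric.isOpen_iff.1 hO _ hmem
  refine ⟨η, hη, fun u hu t ht s hs hEq ↦ ?_⟩
  have hin : (u, t) ∈ Metric.ball (u₀, D.t₁) η := by
    rw [Metric.mem_ball, Prod.dist_eq, max_lt_iff, Real.dist_eq, Real.dist_eq, abs_lt, abs_lt]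
    exact ⟨⟨by linarith [hu.1], by linarith [hu.2]⟩, ⟨by linarith [ht.1], by linarith [ht.2]⟩⟩
  have hnot : e.symm (u, t) ∉ K' := hball hin
  refine ⟨hs.1, ?_⟩
  by_contra hle
  push Not at hle
  exact hnot ⟨s, ⟨hle, hs.2⟩, hEq.symm⟩

/-- **Near `p₁`, a box meets the sack boundary only in the vertical segment (towards `t₂`) and
the plaque to the right of `u₀` at height `t₁`**: a point `e⁻¹ (u, t)` of a small box around
`(u₀, t₁)` with `t ≠ t₁` and (`u ≠ u₀` or `t` outside the height segment), or with `u < u₀`, is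
off the sack boundary. [folklore] -/
theorem exists_box_start (he : e ∈ F.atlas) :
    ∃ η > 0, ∀ u ∈ Ioo (u₀ - η) (u₀ + η), ∀ t ∈ Ioo (D.t₁ - η) (D.t₁ + η),
      (u < u₀ ∨ (t ≠ D.t₁ ∧ (u ≠ u₀ ∨ t ∉ uIcc D.t₂ D.t₁))) → e.symm (u, t) ∉ D.traceX := by
  obtain ⟨ε, hε, hstart⟩ := D.exists_eps_arc_start he
  obtain ⟨η, hη, hnear⟩ := D.exists_nhds_arc_start he hε
  refine ⟨η, hη, fun u hu t ht hcond hmem ↦ ?_⟩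
  -- not on the arc: arc points in the box are at height `t₁` with `u ≥ u₀`
  have harc : e.symm (u, t) ∉ D.arc '' Icc D.a D.b := by
    rintro ⟨s, hs, hsEq⟩
    have hsI := hnear u hu t ht s hs hsEq.symm
    obtain ⟨-, hh, hle⟩ := hstart s hsI
    have h1 : (e (D.arc s)).1 = u := by rw [hsEq, e.right_inv (by rw [F.target_eq e he]; exact mem_univ _)]
    have h2 : (e (D.arc s)).2 = t := by rw [hsEq, e.right_inv (by rw [F.target_eq e he]; exact mem_univ _)]
    rcases hcond with hlt | ⟨hne, -⟩
    · linarith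
    · exact hne (h2 ▸ hh)
  rcases hmem with h | h
  · exact harc h
  · -- on the vertical segment: `u = u₀` and `t ∈ uIcc`
    obtain ⟨t', ht', hEq⟩ := h
    have := congrArg e hEq
    simp only [vert] at this
    rw [e.right_inv (by rw [F.target_eq e he]; exact mem_univ _),
      e.right_inv (by rw [F.target_eq e he]; exact mem_univ _)] at this
    obtain ⟨hu', htt⟩ := Prod.ext_iff.1 this
    simp only at hu' htt
    rcases hcond with hlt | ⟨-, hor⟩
    · linarith
    · rcases hor with hne | hnot
      · exact hne hu'.symm
      · exact hnot (htt ▸ ht')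

/-- **The vertical just beyond `p₁` (on the far side from `t₂`) is in the left side.** An
L-shaped path in a small box: from `(u₀, t)` left along the height `t`, then vertically at
`u = u' < u₀` to an interior height next to `t₁`, whose left points are in the left side.
[folklore] -/
theorem exists_far_mem_leftSide (he : e ∈ F.atlas) (hιc : Continuous ι) (hιi : Injective ι) :
    ∃ η > 0, ∀ t, |t - D.t₁| < η → (t - D.t₁) * (D.t₂ - D.t₁) < 0 → ι (vert e u₀ t) ∈ D.leftSide he ι := by
  obtain ⟨η₁, hη₁, hbox⟩ := D.exists_box_start he
  have hgap : 0 < D.thi - D.tlo := sub_pos.2 D.tlo_lt_thi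
  set η := min η₁ ((D.thi - D.tlo) / 2) with hη
  have hηpos : 0 < η := lt_min hη₁ (by linarith)
  have hη₁' : η ≤ η₁ := min_le_left _ _
  have hη2 : η ≤ (D.thi - D.tlo) / 2 := min_le_right _ _
  -- an interior height `t₀` next to `t₁`
  obtain ⟨t₀, ht₀I, ht₀near⟩ : ∃ t₀, t₀ ∈ Ioo D.tlo D.thi ∧ t₀ ∈ Ioo (D.t₁ - η) (D.t₁ + η) := by
    rcases le_total D.t₁ D.t₂ with h | h
    · have ht₁ : D.tlo = D.t₁ := min_eq_left h
      refine ⟨D.t₁ + η / 2, ⟨?_, ?_⟩, ?_, ?_⟩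
      · rw [ht₁]; linarith
      · rw [ht₁] at hgap hη2; linarith
      · linarith
      · linarith
    · have ht₁ : D.thi = D.t₁ := max_eq_left h
      refine ⟨D.t₁ - η / 2, ⟨?_, ?_⟩, ?_, ?_⟩
      · rw [ht₁] at hgap hη2; linarith
      · rw [ht₁]; linarith
      · linarith
      · linarith
  obtain ⟨δ, hδ, hleft⟩ := D.eventually_mem_leftSide he hιc hιi ht₀I
  refine ⟨η, hηpos, fun t htnear hfar ↦ ?_⟩
  rw [abs_lt] at htnear
  have htI : t ∈ Ioo (D.t₁ - η₁) (D.t₁ + η₁) := ⟨by linarith [htnear.1], by linarith [htnear.2]⟩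
  have htne : t ≠ D.t₁ := by
    intro h; rw [h, sub_self, zero_mul] at hfar; exact lt_irrefl _ hfar
  -- `t` is outside the height segment (far side of `t₁`)
  have htout : t ∉ uIcc D.t₂ D.t₁ := by
    rw [D.uIcc_eq]
    rintro ⟨h1, h2⟩
    rcases lt_or_gt_of_ne D.t₁_ne_t₂ with hlt | hgt
    · have : D.tlo = D.t₁ := min_eq_left hlt.le
      rw [this] at h1
      have : 0 ≤ (t - D.t₁) * (D.t₂ - D.t₁) := mul_nonneg (by linarith) (by linarith)
      linarith
    · have : D.thi = D.t₁ := max_eq_left hgt.le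
      rw [this] at h2
      have : 0 ≤ (t - D.t₁) * (D.t₂ - D.t₁) := mul_nonneg_of_nonpos_of_nonpos (by linarith) (by linarith)
      linarith
  set u' := u₀ - min η δ / 2 with hu'
  have hmin : 0 < min η δ := lt_min hηpos hδ
  have hu'I : u' ∈ Ioo (u₀ - η₁) (u₀ + η₁) := ⟨by rw [hu']; linarith [min_le_left η δ], by rw [hu']; linarith⟩
  have hu'lt : u' < u₀ := by rw [hu']; linarith
  -- `C = (u', t₀)` is in the left side
  have hC : ι (e.symm (u', t₀)) ∈ D.leftSide he ι := hleft u' ⟨by rw [hu']; linarith [min_le_right η δ], hu'lt⟩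
  -- the horizontal piece from `(u', t)` to `(u₀, t)`
  set H := ι '' ((fun q : ℝ × ℝ ↦ e.symm q) '' (Icc u' u₀ ×ˢ ({t} : Set ℝ))) with hH
  have hHc : IsPreconnected H := isPreconnected_image_strip he hιc isPreconnected_Icc isPreconnected_singleton
  have hHsub : H ⊆ (ι '' D.traceX)ᶜ := by
    refine D.image_subset_compl hιi (Set.disjoint_left.2 ?_)
    rintro _ ⟨⟨v, s'⟩, ⟨hv, hs'⟩, rfl⟩
    have hs't : s' = t := hs'
    have hv' : v ∈ Icc u' u₀ := hv
    rw [hs't]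
    refine hbox v ⟨hu'I.1.trans_le hv'.1, hv'.2.trans_lt (by linarith)⟩ t htI (Or.inr ⟨htne, ?_⟩)
    exact Or.inr htout
  -- the vertical piece at `u'` from `t` to `t₀`
  set V := ι '' ((fun q : ℝ × ℝ ↦ e.symm q) '' (({u'} : Set ℝ) ×ˢ Icc (min t t₀) (max t t₀))) with hV
  have hVc : IsPreconnected V := isPreconnected_image_strip he hιc isPreconnected_singleton isPreconnected_Icc
  have hVsub : V ⊆ (ι '' D.traceX)ᶜ := by
    refine D.image_subset_compl hιi (Set.disjoint_left.2 ?_)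
    rintro _ ⟨⟨v, s'⟩, ⟨hv, hs'⟩, rfl⟩
    have hvu : v = u' := hv
    have hs'' : s' ∈ Icc (min t t₀) (max t t₀) := hs'
    rw [hvu]
    refine hbox u' hu'I s' ⟨?_, ?_⟩ (Or.inl hu'lt)
    · have h1 : D.t₁ - η₁ < min t t₀ := lt_min (by linarith [htnear.1]) (by linarith [ht₀near.1])
      exact h1.trans_le hs''.1
    · have h2 : max t t₀ < D.t₁ + η₁ := max_lt (by linarith [htnear.2]) (by linarith [ht₀near.2])
      exact lt_of_le_of_lt hs''.2 h2
  have hA_H : ι (e.symm (u₀, t)) ∈ H := ⟨_, ⟨(u₀, t), ⟨⟨hu'lt.le, le_rfl⟩, rfl⟩, rfl⟩, rfl⟩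
  have hB_H : ι (e.symm (u', t)) ∈ H := ⟨_, ⟨(u', t), ⟨⟨le_rfl, hu'lt.le⟩, rfl⟩, rfl⟩, rfl⟩
  have hB_V : ι (e.symm (u', t)) ∈ V := ⟨_, ⟨(u', t), ⟨rfl, min_le_left _ _, le_max_left _ _⟩, rfl⟩, rfl⟩
  have hC_V : ι (e.symm (u', t₀)) ∈ V := ⟨_, ⟨(u', t₀), ⟨rfl, min_le_right _ _, le_max_right _ _⟩, rfl⟩, rfl⟩
  have hB : ι (e.symm (u', t)) ∈ D.leftSide he ι := by
    have key := hVc.subset_connectedComponentIn hC_V hVsub hB_V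
    rw [leftSide] at hC ⊢
    rwa [connectedComponentIn_eq hC]
  have key := hHc.subset_connectedComponentIn hB_H hHsub hA_H
  rw [leftSide] at hB ⊢
  rw [connectedComponentIn_eq hB]
  exact key

/-- **The far part of the vertical (beyond `p₁`, inside a window free of crossings of the arc) is
in the left side.** [folklore] -/
theorem far_vert_mem_leftSide (he : e ∈ F.atlas) (hιc : Continuous ι) (hιi : Injective ι) {T₁ T₂ : ℝ}
    (hT₁ : T₁ < D.tlo) (hT₂ : D.thi < T₂)
    (hwin : ∀ s, leafLT hbi D.p₁ s → leafLT hbi s D.p₂ → IsCrossing e u₀ s → ht e s ∉ Ioo T₁ T₂)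
    {t : ℝ} (htT : t ∈ Ioo T₁ T₂) (hfar : (t - D.t₁) * (D.t₂ - D.t₁) < 0) : ι (vert e u₀ t) ∈ D.leftSide he ι := by
  obtain ⟨η, hη, hnear⟩ := D.exists_far_mem_leftSide he hιc hιi
  have hne := D.t₁_ne_t₂
  -- the far interval `FarI` (an open interval on the far side of `t₁` inside the window)
  obtain ⟨FarI, hFc, hFt, hFsub, t', ht'F, ht'near, ht'far⟩ : ∃ FarI : Set ℝ, IsPreconnected FarI ∧ t ∈ FarI ∧
      (∀ t' ∈ FarI, t' ∈ Ioo T₁ T₂ ∧ (t' - D.t₁) * (D.t₂ - D.t₁) < 0) ∧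
      ∃ t' ∈ FarI, |t' - D.t₁| < η ∧ (t' - D.t₁) * (D.t₂ - D.t₁) < 0 := by
    rcases lt_or_gt_of_ne hne with hlt | hgt
    · have htlo : D.tlo = D.t₁ := min_eq_left hlt.le
      have ht : t < D.t₁ := by
        by_contra h; push Not at h
        have : 0 ≤ (t - D.t₁) * (D.t₂ - D.t₁) := mul_nonneg (by linarith) (by linarith)
        linarith
      refine ⟨Ioo T₁ D.t₁, isPreconnected_Ioo, ⟨htT.1, ht⟩, fun t' ht' ↦ ⟨⟨ht'.1, ?_⟩, ?_⟩, ?_⟩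
      · linarith [ht'.2, D.tlo_lt_thi]
      · exact mul_neg_of_neg_of_pos (by linarith [ht'.2]) (by linarith)
      · set t' := max (D.t₁ - η / 2) ((T₁ + D.t₁) / 2) with ht'
        have h1 : t' < D.t₁ := max_lt (by linarith) (by rw [htlo] at hT₁; linarith)
        have h2 : T₁ < t' := lt_max_of_lt_right (by rw [htlo] at hT₁; linarith)
        refine ⟨t', ⟨h2, h1⟩, ?_, mul_neg_of_neg_of_pos (by linarith) (by linarith)⟩
        rw [abs_lt]; constructor <;> linarith [le_max_left (D.t₁ - η / 2) ((T₁ + D.t₁) / 2)]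
    · have hthi : D.thi = D.t₁ := max_eq_left hgt.le
      have ht : D.t₁ < t := by
        by_contra h; push Not at h
        have : 0 ≤ (t - D.t₁) * (D.t₂ - D.t₁) := mul_nonneg_of_nonpos_of_nonpos (by linarith) (by linarith)
        linarith
      refine ⟨Ioo D.t₁ T₂, isPreconnected_Ioo, ⟨ht, htT.2⟩, fun t' ht' ↦ ⟨⟨?_, ht'.2⟩, ?_⟩, ?_⟩
      · linarith [ht'.1, D.tlo_lt_thi]
      · exact mul_neg_of_pos_of_neg (by linarith [ht'.1]) (by linarith)
      · set t' := min (D.t₁ + η / 2) ((T₂ + D.t₁) / 2) with ht'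
        have h1 : D.t₁ < t' := lt_min (by linarith) (by rw [hthi] at hT₂; linarith)
        have h2 : t' < T₂ := min_lt_of_right_lt (by rw [hthi] at hT₂; linarith)
        refine ⟨t', ⟨h1, h2⟩, ?_, mul_neg_of_pos_of_neg (by linarith) (by linarith)⟩
        rw [abs_lt]; constructor <;> linarith [min_le_left (D.t₁ + η / 2) ((T₂ + D.t₁) / 2)]
  -- `W = ι ∘ vert '' FarI` is preconnected and off the curve
  set W := (fun s : ℝ ↦ ι (vert e u₀ s)) '' FarI with hW
  have hWc : IsPreconnected W := hFc.image _ (hιc.comp (continuous_vert he)).continuousOn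
  have hWsub : W ⊆ (ι '' D.traceX)ᶜ := by
    rintro _ ⟨s, hs, rfl⟩ ⟨y, hy, hys⟩
    have hy' : y = vert e u₀ s := hιi hys
    subst hy'
    obtain ⟨hsT, hsfar⟩ := hFsub s hs
    have hsne₁ : s ≠ D.t₁ := by intro h; rw [h, sub_self, zero_mul] at hsfar; exact lt_irrefl _ hsfar
    have hsne₂ : s ≠ D.t₂ := by
      intro h; rw [h] at hsfar
      have : 0 ≤ (D.t₂ - D.t₁) * (D.t₂ - D.t₁) := mul_self_nonneg _
      linarith
    rcases hy with ⟨σ, hσ, hσs⟩ | ⟨t'', ht'', hts⟩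
    · -- on the arc: endpoints give `t₁`, `t₂`; interior points give a crossing in the window
      rcases eq_or_lt_of_le hσ.1 with hσa | hσa
      · apply hsne₁
        apply injective_vert (e := e) (u₀ := u₀) he
        rw [← hσs, ← hσa, D.arc_a, D.vert_t₁]
      rcases eq_or_lt_of_le hσ.2 with hσb | hσb
      · apply hsne₂
        apply injective_vert (e := e) (u₀ := u₀) he
        rw [← hσs, hσb, D.arc_b, D.vert_t₂]
      · set r := D.g.symm σ with hr
        have hrs : Leaf.pt r ∈ e.source := by
          show D.arc σ ∈ e.source; rw [hσs]; exact e.map_target (by rw [F.target_eq e he]; exact mem_univ _)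
        have her : e (Leaf.pt r) = (u₀, s) := by
          show e (D.arc σ) = (u₀, s); rw [hσs, vert, e.right_inv (by rw [F.target_eq e he]; exact mem_univ _)]
        have h₁ : leafLT hbi D.p₁ r := by
          rw [leafLT_iff D.p₁_mem (arc_symm_mem D.g_target σ), arc_apply_symm D.g_target]; exact hσa
        have h₂ : leafLT hbi r D.p₂ := by
          rw [leafLT_iff (arc_symm_mem D.g_target σ) D.p₂_mem, arc_apply_symm D.g_target]; exact hσb
        exact hwin r h₁ h₂ ⟨hrs, by rw [her]⟩ (by rw [show ht e r = (e (Leaf.pt r)).2 from rfl, her]; exact hsT)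
    · -- on the segment: height in `[tlo, thi]`, not far
      have hst : s = t'' := (injective_vert he hts).symm ▸ rfl
      rw [← hst, D.uIcc_eq] at ht''
      rcases lt_or_gt_of_ne hne with hlt | hgt
      · rw [show D.tlo = D.t₁ from min_eq_left hlt.le] at ht''
        have : 0 ≤ (s - D.t₁) * (D.t₂ - D.t₁) := mul_nonneg (by linarith [ht''.1]) (by linarith)
        linarith
      · rw [show D.thi = D.t₁ from max_eq_left hgt.le] at ht''
        have : 0 ≤ (s - D.t₁) * (D.t₂ - D.t₁) := mul_nonneg_of_nonpos_of_nonpos (by linarith [ht''.2]) (by linarith)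
        linarith
  have ht'L : ι (vert e u₀ t') ∈ D.leftSide he ι := hnear t' ht'near ht'far
  have key := hWc.subset_connectedComponentIn (mem_image_of_mem _ ht'F) hWsub (mem_image_of_mem _ hFt)
  rw [leftSide] at ht'L ⊢
  rwa [connectedComponentIn_eq ht'L]

/-- **After `p₂` the leaf stays in the right side.** [folklore] -/
theorem mem_rightSide_of_lt (he : e ∈ F.atlas) (hι : IsOpenEmbedding ι) {q : F.Leaf x} (hq : leafLT hbi D.p₂ q) :
    ι (Leaf.pt q) ∈ D.rightSide he ι := by
  have hιc := hι.continuous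
  have hιi := hι.injective
  -- a point `q' > q`
  obtain ⟨q', hqq'⟩ : ∃ q', leafLT hbi q q' := (frequently_leafLT_right (hbi := hbi) q).exists
  set O := leafIoo hbi D.p₂ q' with hO
  set S := (fun s : F.Leaf x ↦ ι (Leaf.pt s)) '' O with hS
  have hSc : IsPreconnected S :=
    (isPreconnected_leafIoo D.p₂ q').image _ (hιc.comp (Leaf.continuous_coe F x)).continuousOn
  have hSsub : S ⊆ (ι '' D.traceX)ᶜ := by
    rintro _ ⟨s, ⟨hs₁, hs₂⟩, rfl⟩ ⟨y, hy, hys⟩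
    have hy' : y = Leaf.pt s := hιi hys
    subst hy'
    rcases hy with ⟨σ, hσ, hσs⟩ | ⟨t, htI, hts⟩
    · have hs : D.g.symm σ = s := Leaf.injective_coe F x hσs
      have hsI : s ∈ leafIcc hbi D.p₁ D.p₂ := hs ▸ D.symm_mem_leafIcc hσ
      exact hsI.2 hs₁
    · -- a crossing after `p₂` with height in `[tlo, thi]`: by the sack lemma it is `p₁` or `p₂`
      have hsrc : Leaf.pt s ∈ e.source := by
        rw [← hts]; exact e.map_target (by rw [F.target_eq e he]; exact mem_univ _)
      have hes : e (Leaf.pt s) = (u₀, t) := by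
        rw [← hts, vert, e.right_inv (by rw [F.target_eq e he]; exact mem_univ _)]
      have hcr : IsCrossing e u₀ s := ⟨hsrc, by rw [hes]⟩
      have hst : ht e s = t := by show (e (Leaf.pt s)).2 = t; rw [hes]
      rw [D.uIcc_eq] at htI
      have hM := D.ht_not_mem_Ioo_of_lt he hι hs₁ hcr
      rw [hst] at hM
      have ht₁₂ : t = D.t₁ ∨ t = D.t₂ := by
        rcases eq_or_lt_of_le htI.1 with h | h
        · rw [tlo] at h
          rcases min_choice D.t₁ D.t₂ with h' | h' <;> rw [h'] at h
          · exact Or.inl h.symm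
          · exact Or.inr h.symm
        rcases eq_or_lt_of_le htI.2 with h' | h'
        · rw [thi] at h'
          rcases max_choice D.t₁ D.t₂ with h'' | h'' <;> rw [h''] at h'
          · exact Or.inl h'
          · exact Or.inr h'
        · exact (hM ⟨h, h'⟩).elim
      rcases ht₁₂ with h | h
      · have := hcr.eq_of_ht_eq D.cross₁ (hst.trans h)
        rw [this] at hs₁
        exact leafLT_asymm D.lt hs₁
      · have := hcr.eq_of_ht_eq D.cross₂ (hst.trans h)
        rw [this] at hs₁
        exact leafLT_irrefl _ hs₁
  -- a point of `S` just after `p₂` in the right side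
  obtain ⟨q₁, hq₁O, hq₁R⟩ : ∃ q₁ ∈ O, ι (Leaf.pt q₁) ∈ D.rightSide he ι := by
    have hev := ((isOpen_setOf_leafLT_left (hbi := hbi) q').mem_nhds (leafLT_trans hq hqq'))
    have h := (frequently_leafLT_right (hbi := hbi) D.p₂).and_eventually
      ((D.eventually_mem_rightSide_after he hιc hιi).and hev)
    obtain ⟨q₁, hlt, himp, hq'⟩ := h.exists
    exact ⟨q₁, ⟨hlt, hq'⟩, himp hlt⟩
  have hqO : q ∈ O := ⟨hq, hqq'⟩
  have key := hSc.subset_connectedComponentIn (mem_image_of_mem _ hq₁O) hSsub (mem_image_of_mem _ hqO)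
  rw [rightSide] at hq₁R ⊢
  rwa [connectedComponentIn_eq hq₁R]

/-- **Far-side exclusion.** Inside a height window `(T₁, T₂) ⊇ [tlo, thi]` in which the leaf arc
does not cross the vertical, no crossing after `p₂` lies on the far side of `t₁` (the side away
from `t₂`): those vertical points are in the left side, the leaf after `p₂` in the right side.
[folklore] -/
theorem not_far_of_lt (he : e ∈ F.atlas) (hι : IsOpenEmbedding ι) {T₁ T₂ : ℝ} (hT₁ : T₁ < D.tlo) (hT₂ : D.thi < T₂)
    (hwin : ∀ s, leafLT hbi D.p₁ s → leafLT hbi s D.p₂ → IsCrossing e u₀ s → ht e s ∉ Ioo T₁ T₂)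
    {q : F.Leaf x} (hq : leafLT hbi D.p₂ q) (hcr : IsCrossing e u₀ q) (hqT : ht e q ∈ Ioo T₁ T₂) :
    0 ≤ (ht e q - D.t₁) * (D.t₂ - D.t₁) := by
  by_contra hfar
  push Not at hfar
  have hL := D.far_vert_mem_leftSide he hι.continuous hι.injective hT₁ hT₂ hwin hqT hfar
  have hR := D.mem_rightSide_of_lt he hι hq
  rw [hcr.pt_eq] at hR
  change ι (vert e u₀ (ht e q)) ∈ D.rightSide he ι at hR
  apply D.rightSide_ne_leftSide he hι
  rw [rightSide] at hR ⊢
  rw [leftSide] at hL ⊢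
  rw [connectedComponentIn_eq hR, ← connectedComponentIn_eq hL]

/-- **Monotone progression.** With the window hypothesis, a crossing after `p₂` with height in
the window lies strictly beyond `t₂`, on the side away from `t₁`. [folklore] -/
theorem beyond_of_lt (he : e ∈ F.atlas) (hι : IsOpenEmbedding ι) {T₁ T₂ : ℝ} (hT₁ : T₁ < D.tlo) (hT₂ : D.thi < T₂)
    (hwin : ∀ s, leafLT hbi D.p₁ s → leafLT hbi s D.p₂ → IsCrossing e u₀ s → ht e s ∉ Ioo T₁ T₂)
    {q : F.Leaf x} (hq : leafLT hbi D.p₂ q) (hcr : IsCrossing e u₀ q) (hqT : ht e q ∈ Ioo T₁ T₂) :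
    0 < (ht e q - D.t₂) * (D.t₂ - D.t₁) := by
  have hnf := D.not_far_of_lt he hι hT₁ hT₂ hwin hq hcr hqT
  have hM := D.ht_not_mem_Ioo_of_lt he hι hq hcr
  have hne₁ : ht e q ≠ D.t₁ := fun h ↦ by
    have := hcr.eq_of_ht_eq D.cross₁ h; rw [this] at hq; exact leafLT_asymm D.lt hq
  have hne₂ : ht e q ≠ D.t₂ := fun h ↦ by
    have := hcr.eq_of_ht_eq D.cross₂ h; rw [this] at hq; exact leafLT_irrefl _ hq
  simp only [mem_Ioo, not_and, not_lt] at hM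
  rcases lt_or_gt_of_ne D.t₁_ne_t₂ with hlt | hgt
  · rw [show D.tlo = D.t₁ from min_eq_left hlt.le, show D.thi = D.t₂ from max_eq_right hlt.le] at hM
    have h1 : D.t₁ < ht e q := by
      by_contra h; push Not at h
      have : (ht e q - D.t₁) * (D.t₂ - D.t₁) ≤ 0 := mul_nonpos_of_nonpos_of_nonneg (by linarith) (by linarith)
      have h0 : (ht e q - D.t₁) * (D.t₂ - D.t₁) = 0 := le_antisymm this hnf
      rcases mul_eq_zero.1 h0 with h' | h'
      · exact hne₁ (by linarith)
      · exact D.t₁_ne_t₂ (by linarith)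
    have h2 : D.t₂ < ht e q := lt_of_le_of_ne (hM h1) (Ne.symm hne₂)
    exact mul_pos (by linarith) (by linarith)
  · rw [show D.tlo = D.t₂ from min_eq_right hgt.le, show D.thi = D.t₁ from max_eq_left hgt.le] at hM
    have h1 : ht e q < D.t₁ := by
      by_contra h; push Not at h
      have : (ht e q - D.t₁) * (D.t₂ - D.t₁) ≤ 0 := mul_nonpos_of_nonneg_of_nonpos (by linarith) (by linarith)
      have h0 : (ht e q - D.t₁) * (D.t₂ - D.t₁) = 0 := le_antisymm this hnf
      rcases mul_eq_zero.1 h0 with h' | h'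
      · exact hne₁ (by linarith)
      · exact D.t₁_ne_t₂ (by linarith)
    have h2 : ht e q < D.t₂ := by
      by_contra h; push Not at h
      rcases eq_or_lt_of_le h with h' | h'
      · exact hne₂ h'.symm
      · exact absurd (hM h') (not_le.2 h1)
    exact mul_pos_of_neg_of_neg (by linarith) (by linarith)

/-! ### Backward in time: the leaf before `p₁` is in the left side -/

/-- **The backward plaque at `p₁` lies in the left side**: the points `e⁻¹ (u, t₁)` with
`u₀ - η < u < u₀` are in the left side (the left part of a small box at `u < u₀` misses the
curve, `exists_box_start`, and its points at a nearby interior height are in the left side).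
[folklore] -/
theorem exists_backward_mem_leftSide (he : e ∈ F.atlas) (hιc : Continuous ι) (hιi : Injective ι) :
    ∃ η > 0, ∀ u ∈ Ioo (u₀ - η) u₀, ι (e.symm (u, D.t₁)) ∈ D.leftSide he ι := by
  obtain ⟨η₁, hη₁, hbox⟩ := D.exists_box_start he
  have hgap : 0 < D.thi - D.tlo := sub_pos.2 D.tlo_lt_thi
  set η := min η₁ ((D.thi - D.tlo) / 2) with hη
  have hηpos : 0 < η := lt_min hη₁ (by linarith)
  have hη₁' : η ≤ η₁ := min_le_left _ _
  obtain ⟨t₀, ht₀I, ht₀near⟩ : ∃ t₀, t₀ ∈ Ioo D.tlo D.thi ∧ t₀ ∈ Ioo (D.t₁ - η) (D.t₁ + η) := by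
    have hη2 : η ≤ (D.thi - D.tlo) / 2 := min_le_right _ _
    rcases le_total D.t₁ D.t₂ with h | h
    · have ht₁ : D.tlo = D.t₁ := min_eq_left h
      refine ⟨D.t₁ + η / 2, ⟨?_, ?_⟩, ?_, ?_⟩
      · rw [ht₁]; linarith
      · rw [ht₁] at hgap hη2; linarith
      · linarith
      · linarith
    · have ht₁ : D.thi = D.t₁ := max_eq_left h
      refine ⟨D.t₁ - η / 2, ⟨?_, ?_⟩, ?_, ?_⟩
      · rw [ht₁] at hgap hη2; linarith
      · rw [ht₁]; linarith
      · linarith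
      · linarith
  obtain ⟨δ, hδ, hleft⟩ := D.eventually_mem_leftSide he hιc hιi ht₀I
  refine ⟨min η δ, lt_min hηpos hδ, fun u hu ↦ ?_⟩
  have huη₁ : u ∈ Ioo (u₀ - η₁) (u₀ + η₁) := ⟨by linarith [hu.1, min_le_left η δ], by linarith [hu.2]⟩
  have hult : u < u₀ := hu.2
  -- the vertical segment at `u` between the heights `t₁` and `t₀`
  set V := ι '' ((fun q : ℝ × ℝ ↦ e.symm q) '' (({u} : Set ℝ) ×ˢ Icc (min t₀ D.t₁) (max t₀ D.t₁))) with hV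
  have hVc : IsPreconnected V := isPreconnected_image_strip he hιc isPreconnected_singleton isPreconnected_Icc
  have hVsub : V ⊆ (ι '' D.traceX)ᶜ := by
    refine D.image_subset_compl hιi (Set.disjoint_left.2 ?_)
    rintro _ ⟨⟨v, t⟩, ⟨hv, ht⟩, rfl⟩
    have hvu : v = u := hv
    have ht' : t ∈ Icc (min t₀ D.t₁) (max t₀ D.t₁) := ht
    rw [hvu]
    refine hbox u huη₁ t ⟨?_, ?_⟩ (Or.inl hult)
    · exact lt_of_lt_of_le (lt_min (by linarith [ht₀near.1]) (by linarith)) ht'.1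
    · exact lt_of_le_of_lt ht'.2 (max_lt (by linarith [ht₀near.2]) (by linarith))
  have hA : ι (e.symm (u, D.t₁)) ∈ V := ⟨_, ⟨(u, D.t₁), ⟨rfl, min_le_right _ _, le_max_right _ _⟩, rfl⟩, rfl⟩
  have hB : ι (e.symm (u, t₀)) ∈ V := ⟨_, ⟨(u, t₀), ⟨rfl, min_le_left _ _, le_max_left _ _⟩, rfl⟩, rfl⟩
  have hBL : ι (e.symm (u, t₀)) ∈ D.leftSide he ι := hleft u ⟨by linarith [hu.1, min_le_right η δ], hult⟩
  have key := hVc.subset_connectedComponentIn hB hVsub hA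
  rw [leftSide] at hBL ⊢
  rwa [connectedComponentIn_eq hBL]

/-- **Just before `p₁`, the leaf is in the left side.** [folklore] -/
theorem eventually_mem_leftSide_before_p₁ (he : e ∈ F.atlas) (hιc : Continuous ι) (hιi : Injective ι) :
    ∀ᶠ q in 𝓝 D.p₁, leafLT hbi q D.p₁ → ι (Leaf.pt q) ∈ D.leftSide he ι := by
  obtain ⟨η, hη, hback⟩ := D.exists_backward_mem_leftSide he hιc hιi
  have hev := eventually_leafLT_iff_lt_fst (hbi := hbi) he D.cross₁
  have hca : ContinuousAt (fun q : F.Leaf x ↦ (e (Leaf.pt q)).1) D.p₁ :=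
    continuous_fst.continuousAt.comp ((e.continuousAt D.cross₁.1).comp (Leaf.continuous_coe F x).continuousAt)
  have hgt : ∀ᶠ q in 𝓝 D.p₁, u₀ - η < (e (Leaf.pt q)).1 := by
    have h0 : u₀ - η < (fun q : F.Leaf x ↦ (e (Leaf.pt q)).1) D.p₁ := by
      show u₀ - η < (e (Leaf.pt D.p₁)).1
      rw [D.cross₁.2]; linarith
    exact hca.eventually (Ioi_mem_nhds h0)
  filter_upwards [hev, hgt] with q hq hqgt hqp
  obtain ⟨hsrc, hht, -, hiff⟩ := hq
  have hu : (e (Leaf.pt q)).1 < u₀ := hiff.1 hqp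
  rw [pt_eq_symm hsrc, hht]
  exact hback _ ⟨hqgt, hu⟩

/-- **Just after a crossing at an interior height, the leaf is in the right side.** [folklore] -/
theorem eventually_mem_rightSide_after' (he : e ∈ F.atlas) (hιc : Continuous ι) (hιi : Injective ι) {r : F.Leaf x}
    (hr : IsCrossing e u₀ r) (hrt : ht e r ∈ Ioo D.tlo D.thi) :
    ∀ᶠ q in 𝓝 r, leafLT hbi r q → ι (Leaf.pt q) ∈ D.rightSide he ι := by
  obtain ⟨δ, hδ, hright⟩ := D.eventually_mem_rightSide he hιc hιi hrt
  have hev := eventually_leafLT_iff_lt_fst (hbi := hbi) he hr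
  have hca : ContinuousAt (fun q : F.Leaf x ↦ (e (Leaf.pt q)).1) r :=
    continuous_fst.continuousAt.comp ((e.continuousAt hr.1).comp (Leaf.continuous_coe F x).continuousAt)
  have hlt : ∀ᶠ q in 𝓝 r, (e (Leaf.pt q)).1 < u₀ + δ := by
    have h0 : (fun q : F.Leaf x ↦ (e (Leaf.pt q)).1) r < u₀ + δ := by
      show (e (Leaf.pt r)).1 < u₀ + δ
      rw [hr.2]; linarith
    exact hca.eventually (Iio_mem_nhds h0)
  filter_upwards [hev, hlt] with q hq hqlt hrq
  obtain ⟨hsrc, hht, hiff, -⟩ := hq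
  have hu : u₀ < (e (Leaf.pt q)).1 := hiff.1 hrq
  rw [pt_eq_symm hsrc, hht]
  exact hright _ ⟨hu, hqlt⟩

/-- **The last crossing before a point** (with height in a closed bounded set). [folklore] -/
theorem exists_last_crossing (he : e ∈ F.atlas) {T : Set ℝ} (hT : IsClosed T) (hTb : Bornology.IsBounded T)
    {p q : F.Leaf x} (hqp : leafLT hbi q p) (hq : IsCrossing e u₀ q) (hqT : ht e q ∈ T) :
    ∃ r, leafLT hbi r p ∧ ¬ leafLT hbi r q ∧ IsCrossing e u₀ r ∧ ht e r ∈ T ∧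
      ∀ s, leafLT hbi r s → leafLT hbi s p → ¬ (IsCrossing e u₀ s ∧ ht e s ∈ T) := by
  set S : Set (F.Leaf x) := {r ∈ leafIcc hbi q p | IsCrossing e u₀ r ∧ ht e r ∈ T} ∩ {r | leafLT hbi r p} with hS
  have hSf : S.Finite := (finite_crossings_leafIcc hbi he hT hTb q p).inter_of_left _
  have hqS : q ∈ S := ⟨⟨left_mem_leafIcc (leafLT_asymm hqp), hq, hqT⟩, hqp⟩
  obtain ⟨n, hn⟩ := exists_subset_lineCharts_source (hbi := hbi) (isCompact_leafIcc (hbi := hbi) q p)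
  obtain ⟨r, hrS, hrmax⟩ := Set.exists_max_image S (lineCharts hbi x n) hSf ⟨q, hqS⟩
  have hrI : r ∈ leafIcc hbi q p := hrS.1.1
  refine ⟨r, hrS.2, hrI.1, hrS.1.2.1, hrS.1.2.2, fun s hrs hsp hs ↦ ?_⟩
  have hqs : leafLT hbi q s := by
    rcases not_leafLT_iff.1 hrI.1 with h | h
    · exact leafLT_trans h hrs
    · exact h ▸ hrs
  have hsS : s ∈ S := ⟨⟨⟨leafLT_asymm hqs, leafLT_asymm hsp⟩, hs⟩, hsp⟩
  have hle := hrmax s hsS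
  have hlt := (leafLT_iff (hn hrI) (hn hsS.1.1)).1 hrs
  exact absurd hle (not_le.2 hlt)

/-- **The Bendixson sack lemma, backward**: before the successive crossings `p₁ < p₂` the open
leaf never crossed the vertical strictly between their heights (the last such crossing `r`
would be left into the right side, while the leaf arrives at `p₁` from the left side).
[folklore] -/
theorem ht_not_mem_Ioo_of_gt (he : e ∈ F.atlas) (hι : IsOpenEmbedding ι) {q : F.Leaf x} (hq : leafLT hbi q D.p₁)
    (hcr : IsCrossing e u₀ q) : ht e q ∉ Ioo D.tlo D.thi := by
  have hιc := hι.continuous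
  have hιi := hι.injective
  intro hqI
  obtain ⟨r, hrp₁, hrq, hr, hrT, hlast⟩ :=
    exists_last_crossing (hbi := hbi) he isClosed_Icc (Metric.isBounded_Icc _ _) hq hcr (Ioo_subset_Icc_self hqI)
  -- its height is interior
  have hrt : ht e r ∈ Ioo D.tlo D.thi := by
    have hne₁ : ht e r ≠ D.t₁ := fun h ↦ by
      have := hr.eq_of_ht_eq D.cross₁ h
      rw [this] at hrp₁
      exact leafLT_irrefl _ hrp₁
    have hne₂ : ht e r ≠ D.t₂ := fun h ↦ by
      have := hr.eq_of_ht_eq D.cross₂ h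
      rw [this] at hrp₁
      exact leafLT_asymm D.lt hrp₁
    refine ⟨lt_of_le_of_ne hrT.1 ?_, lt_of_le_of_ne hrT.2 ?_⟩
    · rw [tlo]; rcases min_choice D.t₁ D.t₂ with h | h <;> rw [h]
      · exact hne₁.symm
      · exact hne₂.symm
    · rw [thi]; rcases max_choice D.t₁ D.t₂ with h | h <;> rw [h]
      · exact hne₁
      · exact hne₂
  -- the open leaf interval `(r, p₁)` maps into the complement of the curve
  set O := leafIoo hbi r D.p₁ with hO
  set S := (fun s : F.Leaf x ↦ ι (Leaf.pt s)) '' O with hS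
  have hSc : IsPreconnected S :=
    (isPreconnected_leafIoo r D.p₁).image _ (hιc.comp (Leaf.continuous_coe F x)).continuousOn
  have hSsub : S ⊆ (ι '' D.traceX)ᶜ := by
    rintro _ ⟨s, ⟨hs₁, hs₂⟩, rfl⟩ ⟨y, hy, hys⟩
    have hy' : y = Leaf.pt s := hιi hys
    subst hy'
    rcases hy with ⟨σ, hσ, hσs⟩ | ⟨t, htI, hts⟩
    · have hs : D.g.symm σ = s := Leaf.injective_coe F x hσs
      have hsI : s ∈ leafIcc hbi D.p₁ D.p₂ := hs ▸ D.symm_mem_leafIcc hσ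
      exact hsI.1 hs₂
    · have hsrc : Leaf.pt s ∈ e.source := by
        rw [← hts]; exact e.map_target (by rw [F.target_eq e he]; exact mem_univ _)
      have hes : e (Leaf.pt s) = (u₀, t) := by
        rw [← hts, vert, e.right_inv (by rw [F.target_eq e he]; exact mem_univ _)]
      refine hlast s hs₁ hs₂ ⟨⟨hsrc, by rw [hes]⟩, ?_⟩
      rw [show ht e s = (e (Leaf.pt s)).2 from rfl, hes, ← D.uIcc_eq]
      exact htI
  -- a point just after `r` in the right side and one just before `p₁` in the left side
  obtain ⟨q₁, hq₁O, hq₁R⟩ : ∃ q₁ ∈ O, ι (Leaf.pt q₁) ∈ D.rightSide he ι := by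
    have hev := ((isOpen_setOf_leafLT_left (hbi := hbi) D.p₁).mem_nhds hrp₁)
    have h := (frequently_leafLT_right (hbi := hbi) r).and_eventually
      ((D.eventually_mem_rightSide_after' he hιc hιi hr hrt).and hev)
    obtain ⟨q₁, hlt, himp, hqp⟩ := h.exists
    exact ⟨q₁, ⟨hlt, hqp⟩, himp hlt⟩
  obtain ⟨q₂, hq₂O, hq₂L⟩ : ∃ q₂ ∈ O, ι (Leaf.pt q₂) ∈ D.leftSide he ι := by
    have hev := ((isOpen_setOf_leafLT_right (hbi := hbi) r).mem_nhds hrp₁)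
    have h := (frequently_leafLT_left (hbi := hbi) D.p₁).and_eventually
      ((D.eventually_mem_leftSide_before_p₁ he hιc hιi).and hev)
    obtain ⟨q₂, hlt, himp, hrq'⟩ := h.exists
    exact ⟨q₂, ⟨hrq', hlt⟩, himp hlt⟩
  have h₁ : S ⊆ connectedComponentIn (ι '' D.traceX)ᶜ (ι (Leaf.pt q₁)) :=
    hSc.subset_connectedComponentIn (mem_image_of_mem _ hq₁O) hSsub
  have h₂ : ι (Leaf.pt q₂) ∈ connectedComponentIn (ι '' D.traceX)ᶜ (ι (Leaf.pt q₁)) := h₁ (mem_image_of_mem _ hq₂O)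
  apply D.rightSide_ne_leftSide he hι
  rw [rightSide] at hq₁R ⊢
  rw [leftSide] at hq₂L ⊢
  rw [connectedComponentIn_eq hq₁R, connectedComponentIn_eq h₂, ← connectedComponentIn_eq hq₂L]

/-- **Before `p₁` the leaf stays in the left side.** [folklore] -/
theorem mem_leftSide_of_gt (he : e ∈ F.atlas) (hι : IsOpenEmbedding ι) {q : F.Leaf x} (hq : leafLT hbi q D.p₁) :
    ι (Leaf.pt q) ∈ D.leftSide he ι := by
  have hιc := hι.continuous
  have hιi := hι.injective
  obtain ⟨q', hq'q⟩ : ∃ q', leafLT hbi q' q := (frequently_leafLT_left (hbi := hbi) q).exists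
  set O := leafIoo hbi q' D.p₁ with hO
  set S := (fun s : F.Leaf x ↦ ι (Leaf.pt s)) '' O with hS
  have hSc : IsPreconnected S :=
    (isPreconnected_leafIoo q' D.p₁).image _ (hιc.comp (Leaf.continuous_coe F x)).continuousOn
  have hSsub : S ⊆ (ι '' D.traceX)ᶜ := by
    rintro _ ⟨s, ⟨hs₁, hs₂⟩, rfl⟩ ⟨y, hy, hys⟩
    have hy' : y = Leaf.pt s := hιi hys
    subst hy'
    rcases hy with ⟨σ, hσ, hσs⟩ | ⟨t, htI, hts⟩
    · have hs : D.g.symm σ = s := Leaf.injective_coe F x hσs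
      have hsI : s ∈ leafIcc hbi D.p₁ D.p₂ := hs ▸ D.symm_mem_leafIcc hσ
      exact hsI.1 hs₂
    · have hsrc : Leaf.pt s ∈ e.source := by
        rw [← hts]; exact e.map_target (by rw [F.target_eq e he]; exact mem_univ _)
      have hes : e (Leaf.pt s) = (u₀, t) := by
        rw [← hts, vert, e.right_inv (by rw [F.target_eq e he]; exact mem_univ _)]
      have hcr : IsCrossing e u₀ s := ⟨hsrc, by rw [hes]⟩
      have hst : ht e s = t := by show (e (Leaf.pt s)).2 = t; rw [hes]
      rw [D.uIcc_eq] at htI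
      have hM := D.ht_not_mem_Ioo_of_gt he hι hs₂ hcr
      rw [hst] at hM
      have ht₁₂ : t = D.t₁ ∨ t = D.t₂ := by
        rcases eq_or_lt_of_le htI.1 with h | h
        · rw [tlo] at h
          rcases min_choice D.t₁ D.t₂ with h' | h' <;> rw [h'] at h
          · exact Or.inl h.symm
          · exact Or.inr h.symm
        rcases eq_or_lt_of_le htI.2 with h' | h'
        · rw [thi] at h'
          rcases max_choice D.t₁ D.t₂ with h'' | h'' <;> rw [h''] at h'
          · exact Or.inl h'
          · exact Or.inr h'
        · exact (hM ⟨h, h'⟩).elim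
      rcases ht₁₂ with h | h
      · have := hcr.eq_of_ht_eq D.cross₁ (hst.trans h)
        rw [this] at hs₂
        exact leafLT_irrefl _ hs₂
      · have := hcr.eq_of_ht_eq D.cross₂ (hst.trans h)
        rw [this] at hs₂
        exact leafLT_asymm D.lt hs₂
  obtain ⟨q₂, hq₂O, hq₂L⟩ : ∃ q₂ ∈ O, ι (Leaf.pt q₂) ∈ D.leftSide he ι := by
    have hev := ((isOpen_setOf_leafLT_right (hbi := hbi) q').mem_nhds (leafLT_trans hq'q hq))
    have h := (frequently_leafLT_left (hbi := hbi) D.p₁).and_eventually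
      ((D.eventually_mem_leftSide_before_p₁ he hιc hιi).and hev)
    obtain ⟨q₂, hlt, himp, hq'lt⟩ := h.exists
    exact ⟨q₂, ⟨hq'lt, hlt⟩, himp hlt⟩
  have hqO : q ∈ O := ⟨hq'q, hq⟩
  have key := hSc.subset_connectedComponentIn (mem_image_of_mem _ hq₂O) hSsub (mem_image_of_mem _ hqO)
  rw [leftSide] at hq₂L ⊢
  rwa [connectedComponentIn_eq hq₂L]

end SackData



end Literature.Topology.PlanarFoliations
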